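import Literature.MathematicalPhysics.QuantumLattice.XYOrderReflection
import Literature.MathematicalPhysics.QuantumLattice.XYOrderInfraredProofs
import Mathlib.Analysis.Matrix.Spectrum
import Mathlib.Analysis.Matrix.PosDef
import HarnessLib

/-!
# Kennedy–Lieb–Shastry, XY model: proof of ground-state Gaussian domination, and the theorem

Trunk T-QLATTICE; sibling proof file of `XYOrderReflection.lean` / `XYOrderInfrared.lean`
(item `provefact-Literature.Hubbard.kennedy_lieb_shastry_xy_ground`). No statement is introduced or
changed. This file **discharges the named fact (GD)** `kls_xy_gaussianDomination_ground`
(`kls_xy_gaussianDomination_ground_holds`) by formalising the direct ground-state proof of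
Kennedy, Lieb and Shastry, J. Stat. Phys. 53 (1988) 1019–1030, pp. 1027–1029, eqs. (18)–(25),
in the XY setting of [KLS1988PRL]; together with `XYOrderInfraredProofs.lean` ((GD) ⇒ (A) ⇒
theorem) this proves **`kennedy_lieb_shastry_xy_ground_holds : kennedy_lieb_shastry_xy_ground`**:
the quantum XY model has ground-state long-range order for all spins and all `d ≥ 2`.

## Contents

* `Matrix.kls_groundEnergy_reflection` — **ground-state reflection positivity, abstractly**
  (eqs. (20)–(25)): for complex-symmetric `A`, `B` and real `Mᵢ`, `Nᵢ`,
  `½E₀(A⊗1 + 1⊗A - ΣMᵢ⊗Mᵢ) + ½E₀(B⊗1 + 1⊗B - ΣNᵢ⊗Nᵢ) ≤ E₀(A⊗1 + 1⊗B - ΣMᵢ⊗Nᵢ)`. The ground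
  state `ψ = vec c` gives `⟨ψ,(X⊗Y)ψ⟩ = tr(cᴴXcYᵀ)` (eq. (22), `Matrix.kronecker_rayleigh`); the
  trace inequality (23)–(24) is proved without the polar decomposition
  (`Matrix.exists_kls_tracePair`: diagonalise `cᴴc = UΛUᴴ`, `W = cU`, `c_R = U√ΛUᴴ`,
  `c_L = W(√Λ)⁺Wᴴ`, and compare termwise in the eigenbasis); the ground state may be complex —
  only the reality of `A, B, Mᵢ, Nᵢ` is used.
* Reality: `S¹` and `iS²` are real matrices, hence so are the rotated bond terms `τ_h` and the
  half-space operators (`xyLeftHamiltonian_transpose`, `xyCrossOp_transpose_eq`).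
* The tensor-square identification along `θ = Torus.reflectBetweenSites j a` (`torusSplit`): single-site operators of the
  left half are `a ⊗ 1`, of the right half `1 ⊗ a` (`onSite_eq_submatrix_kronecker_of_mem`,
  `…_of_not_mem`); left bonds are `τ ⊗ 1`, right bonds `1 ⊗ τ` (reflected field), and a crossing
  bond `{x, θx}` is `(½h_x² - h_xT¹_x) ⊗ 1 + 1 ⊗ (½h_{θx}² - h_{θx}T¹_x) - (T¹_x - h_x) ⊗ (T¹_x - h_{θx})
  - T²_x ⊗ T²_x` (eq. (20), `xyRealBond_cross`); the geometry of the planes (a bond with one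
  endpoint in each half is `{x, θx}`, `eq_torusReflect_of_adj`; `θ` is a graph automorphism
  exchanging left and right bonds) yields the Kronecker form (21)
  `H♭(h) = H^L(h) ⊗ 1 + 1 ⊗ H^L(h∘θ) - Σᵢ Mᵢ(h) ⊗ Mᵢ(h∘θ)` (`xyRealFieldHamiltonian_eq_submatrix`).
* The sublattice rotation (eqs. (15)–(16)): the rotation by `π` about the `1`-axis on the odd
  sublattice of the even torus conjugates `H(h)` into `H♭(h)`
  (`groundEnergy_xyFieldHamiltonian_eq`), whose matrix elements are real.
* `groundEnergy_reflect_le`: **`½E(h^L) + ½E(h^R) ≤ E(h)`** for every pair of planes.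
* The descent (p. 1027 and p. 1029): `badBondCount_reflect`
  (`N(h^L) + N(h^R) + 2N_C(h) = 2N(h)`), and the minimisation over the finitely many fields with
  values in the range of `h`, first of `E`, then of the number of bad bonds
  (`kls_xy_gaussianDomination_ground_holds`); no bad bond forces `H(h) = H`.
* `kennedy_lieb_shastry_xy_ground_holds`.

## References

* [KLS1988PRL] T. Kennedy, E. H. Lieb, B. S. Shastry, *The XY model has long-range order for all
  spins and all dimensions greater than one*, Phys. Rev. Lett. 61 (1988) 2582–2584.
* [KLS1988JSP] T. Kennedy, E. H. Lieb, B. S. Shastry, *Existence of Néel order in some spin-½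
  Heisenberg antiferromagnets*, J. Stat. Phys. 53 (1988) 1019–1030.
* [DLS1978] F. J. Dyson, E. H. Lieb, B. Simon, J. Stat. Phys. 18 (1978) 335–383.
-/

noncomputable section

open Matrix Finset
open scoped ComplexOrder Kronecker InnerProductSpace
open Literature.MathematicalPhysics.QuantumLattice Literature.Probability.LatticeModels

namespace Matrix

open Literature.MathematicalPhysics.QuantumLattice

variable {m : Type*} [Fintype m] [DecidableEq m]

/-! ### Vectors on a product index type as matrices -/

omit [DecidableEq m] in
/-- `(X ⊗ Y) vec(c) = vec(X c Yᵀ)`. [folklore] -/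
theorem kronecker_mulVec_uncurry (X Y c : Matrix m m ℂ) :
    (X ⊗ₖ Y) *ᵥ (fun p : m × m => c p.1 p.2) = fun p => (X * c * Yᵀ) p.1 p.2 := by
  ext ⟨a, b⟩
  simp only [mulVec, dotProduct, kroneckerMap_apply, mul_apply, transpose_apply,
    Fintype.sum_prod_type, Finset.sum_mul]
  rw [Finset.sum_comm]
  refine sum_congr rfl fun d _ => sum_congr rfl fun g _ => ?_
  ring

omit [DecidableEq m] in
/-- `⟨vec c, vec e⟩ = tr(cᴴ e)`. [folklore] -/
theorem star_uncurry_dotProduct_uncurry (c e : Matrix m m ℂ) :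
    star (fun p : m × m => c p.1 p.2) ⬝ᵥ (fun p : m × m => e p.1 p.2) = trace (cᴴ * e) := by
  simp only [dotProduct, trace, diag, mul_apply, conjTranspose_apply, Pi.star_apply,
    Fintype.sum_prod_type]
  rw [Finset.sum_comm]

omit [DecidableEq m] in
/-- **Expectations of Kronecker products** (Kennedy–Lieb–Shastry, J. Stat. Phys. 53 (1988),
eq. (22)): `⟨vec c, (X ⊗ Y) vec c⟩ = tr(cᴴ X c Yᵀ)`. [cite: KLS1988JSP, eq. (22)] -/
theorem kronecker_rayleigh (X Y c : Matrix m m ℂ) :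
    star (fun p : m × m => c p.1 p.2) ⬝ᵥ ((X ⊗ₖ Y) *ᵥ fun p : m × m => c p.1 p.2) =
      trace (cᴴ * X * c * Yᵀ) := by
  rw [kronecker_mulVec_uncurry, star_uncurry_dotProduct_uncurry]
  simp only [Matrix.mul_assoc]

/-! ### The trace inequality (23)–(24), in an SVD-free form -/

/-- `tr(D_u P D_v Pᴴ) = Σ_{k,l} u_k v_l |P_{kl}|²` for diagonal weights. [folklore] -/
theorem trace_diagonal_mul_mul_diagonal_mul_conjTranspose (u v : m → ℂ) (P : Matrix m m ℂ) :
    trace (diagonal u * P * diagonal v * Pᴴ) = ∑ k, ∑ l, u k * v l * (P k l * star (P k l)) := by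
  simp only [trace, diag]
  refine sum_congr rfl fun k _ => ?_
  rw [mul_apply]
  refine sum_congr rfl fun l _ => ?_
  rw [mul_diagonal, diagonal_mul, conjTranspose_apply]
  ring

/-- The elementary inequality `2 re(p q̄) ≤ |p|²/t + t|q|²` for `t > 0`. [folklore] -/
theorem two_mul_re_mul_star_le {p q : ℂ} {t : ℝ} (ht : 0 < t) :
    2 * (p * star q).re ≤ t⁻¹ * (p * star p).re + t * (q * star q).re := by
  have hp : (p * star p).re = ‖p‖ ^ 2 := by
    rw [Complex.star_def, Complex.mul_conj, Complex.ofReal_re, Complex.normSq_eq_norm_sq]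
  have hq : (q * star q).re = ‖q‖ ^ 2 := by
    rw [Complex.star_def, Complex.mul_conj, Complex.ofReal_re, Complex.normSq_eq_norm_sq]
  have h1 : (p * star q).re ≤ ‖p‖ * ‖q‖ := by
    calc (p * star q).re ≤ ‖p * star q‖ := Complex.re_le_norm _
      _ = ‖p‖ * ‖q‖ := by rw [norm_mul, norm_star]
  rw [hp, hq]
  have key : t⁻¹ * ‖p‖ ^ 2 + t * ‖q‖ ^ 2 - 2 * (‖p‖ * ‖q‖) = t⁻¹ * (‖p‖ - t * ‖q‖) ^ 2 := by
    field_simp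
    ring
  nlinarith [key, mul_nonneg (inv_pos.2 ht).le (sq_nonneg (‖p‖ - t * ‖q‖))]

/-- **The Kennedy–Lieb–Shastry trace inequality** (J. Stat. Phys. 53 (1988), eqs. (23)–(24)),
in the form used in (25): for every square matrix `c` there are positive semidefinite `c_L`, `c_R`
with `c_L² = c cᴴ`, `c_R² = cᴴ c` such that for all `M`, `N`,
`2 re tr(cᴴ M c Nᴴ) ≤ re tr(c_L M c_L Mᴴ) + re tr(c_R N c_R Nᴴ)`.
(Proof without the polar decomposition: diagonalise `cᴴc = U Λ Uᴴ`, put `W = cU`, `s = √Λ`,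
`c_R = U s Uᴴ`, `c_L = W s⁺ Wᴴ`; then `tr(cᴴMcNᴴ) = Σ P_{kl} Q̄_{kl}` with `P = WᴴMW`,
`Q = UᴴNU`, and `2|P_{kl} Q_{kl}| ≤ |P_{kl}|²/(s_k s_l) + s_k s_l |Q_{kl}|²`, the columns of `W`
with `s_k = 0` being zero.) [cite: KLS1988JSP, eqs. (23)–(24)] -/
theorem exists_kls_tracePair (c : Matrix m m ℂ) :
    ∃ cL cR : Matrix m m ℂ, cL.PosSemidef ∧ cR.PosSemidef ∧ cL * cL = c * cᴴ ∧
      cR * cR = cᴴ * c ∧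
      ∀ M N : Matrix m m ℂ, 2 * (trace (cᴴ * M * c * Nᴴ)).re ≤
        (trace (cL * M * cL * Mᴴ)).re + (trace (cR * N * cR * Nᴴ)).re := by
  -- spectral decomposition of `cᴴ c = U D Uᴴ`
  have hG : (cᴴ * c).PosSemidef := posSemidef_conjTranspose_mul_self c
  obtain ⟨lam, hlam, U, hUU, hUU', hspec⟩ : ∃ lam : m → ℝ, (∀ k, 0 ≤ lam k) ∧
      ∃ U : Matrix m m ℂ, Uᴴ * U = 1 ∧ U * Uᴴ = 1 ∧
        cᴴ * c = U * diagonal (fun k => ((lam k : ℝ) : ℂ)) * Uᴴ := by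
    refine ⟨hG.1.eigenvalues, fun k => hG.eigenvalues_nonneg k,
      (hG.1.eigenvectorUnitary : Matrix m m ℂ), ?_, ?_, ?_⟩
    · have h := Matrix.mem_unitaryGroup_iff'.1 hG.1.eigenvectorUnitary.2
      rwa [star_eq_conjTranspose] at h
    · have h := Matrix.mem_unitaryGroup_iff.1 hG.1.eigenvectorUnitary.2
      rwa [star_eq_conjTranspose] at h
    · have h := hG.1.spectral_theorem
      rw [Unitary.conjStarAlgAut_apply, star_eq_conjTranspose] at h
      refine h.trans ?_
      congr 2
  set D : Matrix m m ℂ := diagonal (fun k => ((lam k : ℝ) : ℂ)) with hD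
  clear_value D
  -- `s = √λ`, `W = c U`
  obtain ⟨s, hs⟩ : ∃ s : m → ℝ, s = fun k => Real.sqrt (lam k) := ⟨_, rfl⟩
  have hs0 : ∀ k, 0 ≤ s k := fun k => by rw [hs]; exact Real.sqrt_nonneg _
  have hss : ∀ k, s k * s k = lam k := fun k => by rw [hs]; exact Real.mul_self_sqrt (hlam k)
  have hs_eq_zero : ∀ k, s k = 0 → lam k = 0 := fun k h => by
    rw [← hss k, h, mul_zero]
  obtain ⟨W, hW⟩ : ∃ W : Matrix m m ℂ, W = c * U := ⟨_, rfl⟩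
  have hcW : c = W * Uᴴ := by rw [hW, Matrix.mul_assoc, hUU', Matrix.mul_one]
  have hWW : Wᴴ * W = D := by
    rw [hW, conjTranspose_mul, ← Matrix.mul_assoc, Matrix.mul_assoc Uᴴ, hspec]
    simp only [Matrix.mul_assoc]
    rw [hUU, Matrix.mul_one, ← Matrix.mul_assoc, hUU, Matrix.one_mul]
  -- columns of `W` with `λ_k = 0` vanish
  have hWcol : ∀ k, lam k = 0 → ∀ i, W i k = 0 := by
    intro k hk i
    have h := congrFun (congrFun hWW k) k
    simp only [mul_apply, conjTranspose_apply, hD, diagonal_apply_eq, hk, Complex.ofReal_zero]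
      at h
    have h' : ∑ j, Complex.normSq (W j k) = 0 := by
      have : ∑ j, ((Complex.normSq (W j k) : ℝ) : ℂ) = 0 := by
        rw [← h]
        refine sum_congr rfl fun j _ => ?_
        rw [Complex.star_def, Complex.normSq_eq_conj_mul_self]
      exact_mod_cast this
    have h'' := (sum_eq_zero_iff_of_nonneg fun j _ => Complex.normSq_nonneg (W j k)).1 h' i
      (mem_univ i)
    exact Complex.normSq_eq_zero.1 h''
  -- the two square roots
  obtain ⟨S, hS⟩ : ∃ S : Matrix m m ℂ, S = diagonal (fun k => ((s k : ℝ) : ℂ)) := ⟨_, rfl⟩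
  obtain ⟨Sp, hSp⟩ : ∃ Sp : Matrix m m ℂ, Sp = diagonal (fun k => (((s k)⁻¹ : ℝ) : ℂ)) :=
    ⟨_, rfl⟩
  obtain ⟨cR, hcR⟩ : ∃ cR : Matrix m m ℂ, cR = U * S * Uᴴ := ⟨_, rfl⟩
  obtain ⟨cL, hcL⟩ : ∃ cL : Matrix m m ℂ, cL = W * Sp * Wᴴ := ⟨_, rfl⟩
  have hSpsd : S.PosSemidef := by
    rw [hS]; exact posSemidef_diagonal_iff.2 fun k => Complex.zero_le_real.2 (hs0 k)
  have hSppsd : Sp.PosSemidef := by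
    rw [hSp]
    exact posSemidef_diagonal_iff.2 fun k => Complex.zero_le_real.2 (inv_nonneg.2 (hs0 k))
  refine ⟨cL, cR, ?_, ?_, ?_, ?_, ?_⟩
  · rw [hcL]
    simpa only [conjTranspose_conjTranspose] using hSppsd.mul_mul_conjTranspose_same W
  · rw [hcR]
    simpa only [conjTranspose_conjTranspose] using hSpsd.mul_mul_conjTranspose_same U
  · -- `c_L² = W Sp D Sp Wᴴ = W 𝟙_{λ≠0} Wᴴ = W Wᴴ = c cᴴ`
    have hind : W * (Sp * D * Sp) = W := by
      ext i k
      rw [hSp, hD, diagonal_mul_diagonal, diagonal_mul_diagonal, mul_diagonal]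
      by_cases hk : lam k = 0
      · rw [hWcol k hk i, zero_mul]
      · have hsk : s k ≠ 0 := fun h0 => hk (hs_eq_zero k h0)
        rw [← hss k]
        push_cast
        field_simp
    calc cL * cL = W * (Sp * (Wᴴ * W) * Sp) * Wᴴ := by
          rw [hcL]; simp only [Matrix.mul_assoc]
      _ = W * Wᴴ := by rw [hWW, hind]
      _ = c * cᴴ := by
          rw [hcW, conjTranspose_mul, conjTranspose_conjTranspose, Matrix.mul_assoc,
            ← Matrix.mul_assoc Uᴴ, hUU, Matrix.one_mul]
  · -- `c_R² = U S² Uᴴ = U D Uᴴ = cᴴ c`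
    have hSS : S * S = D := by
      rw [hS, hD, diagonal_mul_diagonal]
      congr 1
      funext k
      rw [← Complex.ofReal_mul, hss]
    calc cR * cR = U * (S * (Uᴴ * U) * S) * Uᴴ := by rw [hcR]; simp only [Matrix.mul_assoc]
      _ = cᴴ * c := by rw [hUU, Matrix.mul_one, hSS, hspec, hD]
  · intro M N
    obtain ⟨P, hP⟩ : ∃ P : Matrix m m ℂ, P = Wᴴ * M * W := ⟨_, rfl⟩
    obtain ⟨Q, hQ⟩ : ∃ Q : Matrix m m ℂ, Q = Uᴴ * N * U := ⟨_, rfl⟩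
    have hPh : Pᴴ = Wᴴ * Mᴴ * W := by
      rw [hP, conjTranspose_mul, conjTranspose_mul, conjTranspose_conjTranspose, Matrix.mul_assoc]
    have hQh : Qᴴ = Uᴴ * Nᴴ * U := by
      rw [hQ, conjTranspose_mul, conjTranspose_mul, conjTranspose_conjTranspose, Matrix.mul_assoc]
    -- the three traces in the eigenbasis
    have h1 : trace (cᴴ * M * c * Nᴴ) = ∑ k, ∑ l, P k l * star (Q k l) := by
      have e1 : cᴴ * M * c * Nᴴ = U * (P * Qᴴ) * Uᴴ := by
        rw [hQh, hP, hcW, conjTranspose_mul, conjTranspose_conjTranspose]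
        simp only [Matrix.mul_assoc]
        rw [hUU', Matrix.mul_one]
      rw [e1, trace_mul_cycle, hUU, Matrix.one_mul]
      simp only [trace, diag, mul_apply, conjTranspose_apply]
    have h2 : trace (cR * N * cR * Nᴴ) =
        ∑ k, ∑ l, ((s k : ℝ) : ℂ) * ((s l : ℝ) : ℂ) * (Q k l * star (Q k l)) := by
      have e2 : cR * N * cR * Nᴴ = U * (S * Q * S * Qᴴ) * Uᴴ := by
        rw [hQh, hQ, hcR]
        simp only [Matrix.mul_assoc]
        rw [hUU', Matrix.mul_one]
      rw [e2, trace_mul_cycle, hUU, Matrix.one_mul, hS,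
        trace_diagonal_mul_mul_diagonal_mul_conjTranspose]
    have h3 : trace (cL * M * cL * Mᴴ) =
        ∑ k, ∑ l, (((s k)⁻¹ : ℝ) : ℂ) * (((s l)⁻¹ : ℝ) : ℂ) * (P k l * star (P k l)) := by
      have e3 : cL * M * cL * Mᴴ = W * (Sp * P * Sp * (Wᴴ * Mᴴ)) := by
        rw [hP, hcL]
        simp only [Matrix.mul_assoc]
      rw [e3, trace_mul_comm, show Sp * P * Sp * (Wᴴ * Mᴴ) * W = Sp * P * Sp * Pᴴ by
        rw [hPh]; simp only [Matrix.mul_assoc], hSp,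
        trace_diagonal_mul_mul_diagonal_mul_conjTranspose]
    -- entries of `P` in a null column/row of `W` vanish
    have hP0 : ∀ k l, s k * s l = 0 → P k l = 0 := by
      intro k l hkl
      have hcases : lam k = 0 ∨ lam l = 0 := by
        rcases mul_eq_zero.1 hkl with h | h
        · exact Or.inl (hs_eq_zero k h)
        · exact Or.inr (hs_eq_zero l h)
      rw [hP, Matrix.mul_assoc]
      simp only [mul_apply, conjTranspose_apply]
      refine sum_eq_zero fun i _ => ?_
      rcases hcases with hk | hl
      · rw [hWcol k hk i, star_zero, zero_mul]
      · rw [sum_eq_zero fun j _ => by rw [hWcol l hl j, mul_zero], mul_zero]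
    -- termwise comparison
    rw [h1, h2, h3, Complex.re_sum, Complex.re_sum, Complex.re_sum, mul_sum, ← sum_add_distrib]
    refine sum_le_sum fun k _ => ?_
    rw [Complex.re_sum, Complex.re_sum, Complex.re_sum, mul_sum, ← sum_add_distrib]
    refine sum_le_sum fun l _ => ?_
    rw [← Complex.ofReal_mul, ← Complex.ofReal_mul, Complex.re_ofReal_mul, Complex.re_ofReal_mul]
    by_cases hkl : s k * s l = 0
    · rw [hP0 k l hkl, zero_mul, star_zero, mul_zero, Complex.zero_re, mul_zero, mul_zero, hkl,
        zero_mul, add_zero]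
    · have ht : 0 < s k * s l := lt_of_le_of_ne (mul_nonneg (hs0 k) (hs0 l)) (Ne.symm hkl)
      have h := two_mul_re_mul_star_le (p := P k l) (q := Q k l) ht
      rwa [mul_inv] at h

/-! ### The reflection inequality for Kronecker-structured Hamiltonians -/

omit [Fintype m] [DecidableEq m] in
/-- For a matrix with real entries, `Nᵀ = Nᴴ`. [folklore] -/
theorem transpose_eq_conjTranspose_of_star_apply {N : Matrix m m ℂ}
    (hN : ∀ a b, star (N a b) = N a b) : Nᵀ = Nᴴ := by
  ext a b
  rw [transpose_apply, conjTranspose_apply, hN]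

/-- Expansion of the Rayleigh quotient of `K(X, Y, Z, V) = X ⊗ 1 + 1 ⊗ Y - Σᵢ Zᵢ ⊗ Vᵢ` at
`vec e`: `tr(eᴴ X e) + tr(eᴴ e Yᵀ) - Σᵢ tr(eᴴ Zᵢ e Vᵢᵀ)` (Kennedy–Lieb–Shastry, J. Stat. Phys.
53 (1988), eq. (22)). [cite: KLS1988JSP, eq. (22)] -/
theorem kronecker_hamiltonian_rayleigh {ι : Type*} [Fintype ι] (X Y : Matrix m m ℂ)
    (Z V : ι → Matrix m m ℂ) (e : Matrix m m ℂ) :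
    star (fun p : m × m => e p.1 p.2) ⬝ᵥ
        ((X ⊗ₖ (1 : Matrix m m ℂ) + (1 : Matrix m m ℂ) ⊗ₖ Y - ∑ i, Z i ⊗ₖ V i) *ᵥ
          fun p : m × m => e p.1 p.2) =
      trace (eᴴ * X * e) + trace (eᴴ * e * Yᵀ) - ∑ i, trace (eᴴ * Z i * e * (V i)ᵀ) := by
  rw [sub_mulVec, add_mulVec, dotProduct_sub, dotProduct_add, kronecker_rayleigh,
    kronecker_rayleigh, transpose_one, Matrix.mul_one, Matrix.mul_one, Matrix.sum_mulVec,
    dotProduct_sum]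
  simp only [kronecker_rayleigh]

/-- **Ground-state reflection positivity, variational form** (Kennedy–Lieb–Shastry, J. Stat.
Phys. 53 (1988), eqs. (20)–(25), abstracted). Let `A`, `B` be complex-symmetric (`Aᵀ = A`,
`Bᵀ = B`), `Mᵢ`, `Nᵢ` real matrices (`Xᵀ = Xᴴ`), and `K(A, B, M, N) = A ⊗ 1 + 1 ⊗ B - Σᵢ Mᵢ ⊗ Nᵢ`. For
every `c` with `tr(cᴴc) = 1` there are `c_L`, `c_R` with `tr(c_Lᴴ c_L) = tr(c_Rᴴ c_R) = 1` and
`½ re⟨vec c_L, K(A,A,M,M) vec c_L⟩ + ½ re⟨vec c_R, K(B,B,N,N) vec c_R⟩ ≤ re⟨vec c, K(A,B,M,N) vec c⟩`.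
[cite: KLS1988JSP, eqs. (20)–(25)] -/
theorem kls_reflection_rayleigh {ι : Type*} [Fintype ι] (A B : Matrix m m ℂ)
    (M N : ι → Matrix m m ℂ) (hA : Aᵀ = A) (hB : Bᵀ = B)
    (hMt : ∀ i, (M i)ᵀ = (M i)ᴴ) (hNt : ∀ i, (N i)ᵀ = (N i)ᴴ)
    (c : Matrix m m ℂ) (hc : trace (cᴴ * c) = 1) :
    ∃ cL cR : Matrix m m ℂ, trace (cLᴴ * cL) = 1 ∧ trace (cRᴴ * cR) = 1 ∧
      ((star (fun p : m × m => cL p.1 p.2) ⬝ᵥ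
          ((A ⊗ₖ (1 : Matrix m m ℂ) + (1 : Matrix m m ℂ) ⊗ₖ A - ∑ i, M i ⊗ₖ M i) *ᵥ
            fun p : m × m => cL p.1 p.2)).re +
        (star (fun p : m × m => cR p.1 p.2) ⬝ᵥ
          ((B ⊗ₖ (1 : Matrix m m ℂ) + (1 : Matrix m m ℂ) ⊗ₖ B - ∑ i, N i ⊗ₖ N i) *ᵥ
            fun p : m × m => cR p.1 p.2)).re) / 2 ≤
      (star (fun p : m × m => c p.1 p.2) ⬝ᵥ
          ((A ⊗ₖ (1 : Matrix m m ℂ) + (1 : Matrix m m ℂ) ⊗ₖ B - ∑ i, M i ⊗ₖ N i) *ᵥ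
            fun p : m × m => c p.1 p.2)).re := by
  obtain ⟨cL, cR, hLpsd, hRpsd, hLsq, hRsq, hineq⟩ := exists_kls_tracePair c
  refine ⟨cL, cR, ?_, ?_, ?_⟩
  · rw [hLpsd.1.eq, hLsq, trace_mul_comm, hc]
  · rw [hRpsd.1.eq, hRsq, hc]
  rw [kronecker_hamiltonian_rayleigh, kronecker_hamiltonian_rayleigh,
    kronecker_hamiltonian_rayleigh]
  simp only [hMt, hNt, hLpsd.1.eq, hRpsd.1.eq, hA, hB, Complex.add_re, Complex.sub_re,
    Complex.re_sum]
  -- identify the quadratic terms: all equal `tr(A c cᴴ)`, `tr(B cᴴ c)`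
  have t1 : trace (cL * A * cL) = trace (cᴴ * A * c) := by
    rw [trace_mul_cycle, hLsq, Matrix.mul_assoc, trace_mul_comm]
  have t2 : trace (cL * cL * A) = trace (cᴴ * A * c) := by
    rw [hLsq, Matrix.mul_assoc, trace_mul_comm, Matrix.mul_assoc]
  have t3 : trace (cR * B * cR) = trace (cᴴ * c * B) := by
    rw [trace_mul_cycle, hRsq]
  have t4 : trace (cR * cR * B) = trace (cᴴ * c * B) := by
    rw [hRsq]
  rw [t1, t2, t3, t4]
  have hsum : 2 * (∑ i, (trace (cᴴ * M i * c * (N i)ᴴ)).re) ≤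
      ∑ i, (trace (cL * M i * cL * (M i)ᴴ)).re + ∑ i, (trace (cR * N i * cR * (N i)ᴴ)).re := by
    rw [mul_sum, ← sum_add_distrib]
    exact sum_le_sum fun i _ => by linarith [hineq (M i) (N i)]
  linarith [hsum]

/-- A normalised ground-state vector exists (Hermitian matrix, nonempty index type). [folklore] -/
theorem exists_groundState_unit {n : Type*} [Fintype n] [DecidableEq n] [Nonempty n]
    {A : Matrix n n ℂ} (hA : A.IsHermitian) :
    ∃ ψ : n → ℂ, star ψ ⬝ᵥ ψ = 1 ∧ (star ψ ⬝ᵥ A *ᵥ ψ).re = A.groundEnergy := by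
  obtain ⟨v, hv, hv0⟩ := (Submodule.ne_bot_iff _).1 (groundSpace_ne_bot_holds hA)
  have hpos : 0 < ‖(WithLp.toLp 2 v : EuclideanSpace ℂ n)‖ := by
    rw [norm_pos_iff]
    intro h
    exact hv0 (by simpa using congrArg WithLp.ofLp h)
  set ψ : n → ℂ := ((‖(WithLp.toLp 2 v : EuclideanSpace ℂ n)‖ : ℂ))⁻¹ • v with hψ
  have hψmem : ψ ∈ A.groundSpace := A.groundSpace.smul_mem _ hv
  have hψ1 : star ψ ⬝ᵥ ψ = 1 := by
    have h1 : ⟪(WithLp.toLp 2 v : EuclideanSpace ℂ n), WithLp.toLp 2 v⟫_ℂ = star v ⬝ᵥ v := by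
      rw [EuclideanSpace.inner_eq_star_dotProduct, dotProduct_comm]
    have hvv : star v ⬝ᵥ v = ((‖(WithLp.toLp 2 v : EuclideanSpace ℂ n)‖ : ℂ)) ^ 2 := by
      rw [← h1, inner_self_eq_norm_sq_to_K]
      rfl
    rw [hψ, star_smul, smul_dotProduct, dotProduct_smul, hvv, smul_eq_mul, smul_eq_mul]
    have hc0 : ((‖(WithLp.toLp 2 v : EuclideanSpace ℂ n)‖ : ℂ)) ≠ 0 := by
      exact_mod_cast hpos.ne'
    simp only [Complex.star_def, map_inv₀, Complex.conj_ofReal]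
    field_simp
  exact ⟨ψ, hψ1, (rayleigh_eq_groundEnergy_iff_holds hA ψ hψ1).2 hψmem⟩

/-- **Ground-state reflection positivity** (Kennedy–Lieb–Shastry, J. Stat. Phys. 53 (1988),
the inequality `E(h̄) ≥ ½E(h^L) + ½E(h^R)` after eq. (25), abstracted): for Hermitian
`K(A,B,M,N)`, `K(A,A,M,M)`, `K(B,B,N,N)` with `Aᵀ = A`, `Bᵀ = B` and real `Mᵢ`, `Nᵢ`,
`½ E₀(K(A,A,M,M)) + ½ E₀(K(B,B,N,N)) ≤ E₀(K(A,B,M,N))`. [cite: KLS1988JSP, eqs. (20)–(25)] -/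
theorem kls_groundEnergy_reflection [Nonempty m] {ι : Type*} [Fintype ι] (A B : Matrix m m ℂ)
    (M N : ι → Matrix m m ℂ) (hA : Aᵀ = A) (hB : Bᵀ = B)
    (hM : ∀ i, (M i)ᵀ = (M i)ᴴ) (hN : ∀ i, (N i)ᵀ = (N i)ᴴ)
    (hK : (A ⊗ₖ (1 : Matrix m m ℂ) + (1 : Matrix m m ℂ) ⊗ₖ B - ∑ i, M i ⊗ₖ N i).IsHermitian)
    (hKL : (A ⊗ₖ (1 : Matrix m m ℂ) + (1 : Matrix m m ℂ) ⊗ₖ A - ∑ i, M i ⊗ₖ M i).IsHermitian)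
    (hKR : (B ⊗ₖ (1 : Matrix m m ℂ) + (1 : Matrix m m ℂ) ⊗ₖ B - ∑ i, N i ⊗ₖ N i).IsHermitian) :
    ((A ⊗ₖ (1 : Matrix m m ℂ) + (1 : Matrix m m ℂ) ⊗ₖ A - ∑ i, M i ⊗ₖ M i).groundEnergy +
        (B ⊗ₖ (1 : Matrix m m ℂ) + (1 : Matrix m m ℂ) ⊗ₖ B - ∑ i, N i ⊗ₖ N i).groundEnergy) / 2 ≤
      (A ⊗ₖ (1 : Matrix m m ℂ) + (1 : Matrix m m ℂ) ⊗ₖ B - ∑ i, M i ⊗ₖ N i).groundEnergy := by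
  obtain ⟨ψ, hψ1, hψE⟩ := exists_groundState_unit hK
  -- `ψ = vec c`
  set c : Matrix m m ℂ := Matrix.of fun a b => ψ (a, b) with hc_def
  have hψc : (fun p : m × m => c p.1 p.2) = ψ := by
    funext p; rfl
  have hc : trace (cᴴ * c) = 1 := by rw [← star_uncurry_dotProduct_uncurry, hψc, hψ1]
  obtain ⟨cL, cR, hL1, hR1, hineq⟩ := kls_reflection_rayleigh A B M N hA hB hM hN c hc
  rw [hψc, hψE] at hineq
  have hL := groundEnergy_le_rayleigh_holds hKL (fun p : m × m => cL p.1 p.2)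
    (by rw [star_uncurry_dotProduct_uncurry, hL1])
  have hR := groundEnergy_le_rayleigh_holds hKR (fun p : m × m => cR p.1 p.2)
    (by rw [star_uncurry_dotProduct_uncurry, hR1])
  linarith

end Matrix

namespace Literature.MathematicalPhysics.QuantumLattice

variable {d : ℕ}

/-! ### The reflection between sites, pointwise -/

section ReflHelpers

variable (L : ℕ) (j : Fin d) (a : ZMod L)

/-- `θ(θx) = x` for `θ = Torus.reflectBetweenSites j a` (pointwise form of
`Torus.reflectBetweenSites_involutive`). [folklore] -/
@[simp] theorem reflectBetweenSites_reflectBetweenSites (x : TorusSite d L) :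
    Torus.reflectBetweenSites j a (Torus.reflectBetweenSites j a x) = x :=
  Torus.reflectBetweenSites_involutive j a x

end ReflHelpers

/-! ### Kronecker algebra helpers -/

section KroneckerHelpers

variable {m n : Type*} [Fintype m] [Fintype n]

omit [Fintype m] [Fintype n] in
/-- `(A₁ - A₂) ⊗ B = A₁ ⊗ B - A₂ ⊗ B`. [folklore] -/
theorem sub_kronecker (A₁ A₂ : Matrix m m ℂ) (B : Matrix n n ℂ) :
    (A₁ - A₂) ⊗ₖ B = A₁ ⊗ₖ B - A₂ ⊗ₖ B := by
  ext ⟨i, k⟩ ⟨j, l⟩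
  simp [kroneckerMap_apply, sub_mul]

omit [Fintype m] [Fintype n] in
/-- `A ⊗ (B₁ - B₂) = A ⊗ B₁ - A ⊗ B₂`. [folklore] -/
theorem kronecker_sub (A : Matrix m m ℂ) (B₁ B₂ : Matrix n n ℂ) :
    A ⊗ₖ (B₁ - B₂) = A ⊗ₖ B₁ - A ⊗ₖ B₂ := by
  ext ⟨i, k⟩ ⟨j, l⟩
  simp [kroneckerMap_apply, mul_sub]

omit [Fintype m] [Fintype n] in
/-- `(Σᵢ Aᵢ) ⊗ B = Σᵢ Aᵢ ⊗ B`. [folklore] -/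
theorem sum_kronecker {ι : Type*} (s : Finset ι) (A : ι → Matrix m m ℂ) (B : Matrix n n ℂ) :
    (∑ i ∈ s, A i) ⊗ₖ B = ∑ i ∈ s, A i ⊗ₖ B := by
  ext ⟨i, k⟩ ⟨j, l⟩
  simp [kroneckerMap_apply, Matrix.sum_apply, Finset.sum_mul]

omit [Fintype m] [Fintype n] in
/-- `A ⊗ (Σᵢ Bᵢ) = Σᵢ A ⊗ Bᵢ`. [folklore] -/
theorem kronecker_sum {ι : Type*} (s : Finset ι) (A : Matrix m m ℂ) (B : ι → Matrix n n ℂ) :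
    A ⊗ₖ (∑ i ∈ s, B i) = ∑ i ∈ s, A ⊗ₖ B i := by
  ext ⟨i, k⟩ ⟨j, l⟩
  simp [kroneckerMap_apply, Matrix.sum_apply, Finset.mul_sum]

variable [DecidableEq m] [DecidableEq n]

/-- `(A ⊗ 1)(1 ⊗ B) = A ⊗ B`. [folklore] -/
theorem kronecker_one_mul_one_kronecker (A : Matrix m m ℂ) (B : Matrix n n ℂ) :
    A ⊗ₖ (1 : Matrix n n ℂ) * (1 : Matrix m m ℂ) ⊗ₖ B = A ⊗ₖ B := by
  rw [← mul_kronecker_mul, Matrix.mul_one, Matrix.one_mul]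

/-- `(1 ⊗ B)(A ⊗ 1) = A ⊗ B`. [folklore] -/
theorem one_kronecker_mul_kronecker_one (A : Matrix m m ℂ) (B : Matrix n n ℂ) :
    (1 : Matrix m m ℂ) ⊗ₖ B * A ⊗ₖ (1 : Matrix n n ℂ) = A ⊗ₖ B := by
  rw [← mul_kronecker_mul, Matrix.mul_one, Matrix.one_mul]

end KroneckerHelpers

/-! ### Real matrices: `Xᵀ = Xᴴ` -/

section RealMatrices

variable {m : Type*}

/-- A complex matrix is real iff `Xᵀ = Xᴴ`; closure under products. [folklore] -/
theorem transpose_eq_conjTranspose_mul [Fintype m] {X Y : Matrix m m ℂ} (hX : Xᵀ = Xᴴ)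
    (hY : Yᵀ = Yᴴ) : (X * Y)ᵀ = (X * Y)ᴴ := by
  rw [transpose_mul, conjTranspose_mul, hX, hY]

/-- Real matrices are closed under sums. [folklore] -/
theorem transpose_eq_conjTranspose_add {X Y : Matrix m m ℂ} (hX : Xᵀ = Xᴴ) (hY : Yᵀ = Yᴴ) :
    (X + Y)ᵀ = (X + Y)ᴴ := by
  rw [transpose_add, conjTranspose_add, hX, hY]

/-- Real matrices are closed under differences. [folklore] -/
theorem transpose_eq_conjTranspose_sub {X Y : Matrix m m ℂ} (hX : Xᵀ = Xᴴ) (hY : Yᵀ = Yᴴ) :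
    (X - Y)ᵀ = (X - Y)ᴴ := by
  rw [transpose_sub, conjTranspose_sub, hX, hY]

/-- Real matrices are closed under negation. [folklore] -/
theorem transpose_eq_conjTranspose_neg {X : Matrix m m ℂ} (hX : Xᵀ = Xᴴ) : (-X)ᵀ = (-X)ᴴ := by
  rw [transpose_neg, conjTranspose_neg, hX]

/-- Real matrices are closed under finite sums. [folklore] -/
theorem transpose_eq_conjTranspose_sum {ι : Type*} (s : Finset ι) {X : ι → Matrix m m ℂ}
    (hX : ∀ i ∈ s, (X i)ᵀ = (X i)ᴴ) : (∑ i ∈ s, X i)ᵀ = (∑ i ∈ s, X i)ᴴ := by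
  rw [transpose_sum, conjTranspose_sum]
  exact sum_congr rfl hX

/-- Real matrices are closed under real scalar multiples. [folklore] -/
theorem transpose_eq_conjTranspose_ofReal_smul {X : Matrix m m ℂ} (hX : Xᵀ = Xᴴ) (r : ℝ) :
    ((r : ℂ) • X)ᵀ = ((r : ℂ) • X)ᴴ := by
  rw [transpose_smul, conjTranspose_smul, hX, Complex.star_def, Complex.conj_ofReal]

/-- The identity matrix is real. [folklore] -/
theorem transpose_eq_conjTranspose_one [DecidableEq m] :
    (1 : Matrix m m ℂ)ᵀ = (1 : Matrix m m ℂ)ᴴ := by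
  rw [transpose_one, conjTranspose_one]

/-- Real matrices are closed under Kronecker products. [folklore] -/
theorem transpose_eq_conjTranspose_kronecker {n : Type*} {X : Matrix m m ℂ} {Y : Matrix n n ℂ}
    (hX : Xᵀ = Xᴴ) (hY : Yᵀ = Yᴴ) : (X ⊗ₖ Y)ᵀ = (X ⊗ₖ Y)ᴴ := by
  ext ⟨i, k⟩ ⟨j, l⟩
  have h1 := congrFun (congrFun hX i) j
  have h2 := congrFun (congrFun hY k) l
  simp only [transpose_apply, conjTranspose_apply] at h1 h2
  simp only [transpose_apply, conjTranspose_apply, kroneckerMap_apply, star_mul']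
  rw [← h1, ← h2]

end RealMatrices

section RealSpin

variable {Λ : Type*} [Fintype Λ] [DecidableEq Λ]

/-- `onSite x` commutes with transposition. [folklore] -/
theorem onSite_transpose {q : ℕ} (x : Λ) (a : Matrix (Fin q) (Fin q) ℂ) :
    (onSite x a : Op Λ q)ᵀ = onSite x aᵀ := by
  ext σ τ
  simp only [transpose_apply, onSite_apply]
  have h : (∀ y, y ≠ x → τ y = σ y) ↔ (∀ y, y ≠ x → σ y = τ y) :=
    ⟨fun h y hy => (h y hy).symm, fun h y hy => (h y hy).symm⟩
  rw [if_congr h rfl rfl]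

/-- `onSite x a` is real if `a` is. [folklore] -/
theorem transpose_eq_conjTranspose_onSite {q : ℕ} (x : Λ) {a : Matrix (Fin q) (Fin q) ℂ}
    (ha : aᵀ = aᴴ) : (onSite x a : Op Λ q)ᵀ = (onSite x a)ᴴ := by
  rw [onSite_transpose, ← onSite_conjTranspose, ha]

/-- A matrix with star-fixed entries is real: `Xᵀ = Xᴴ`. [folklore] -/
theorem transpose_eq_conjTranspose_of_star {m : Type*} {X : Matrix m m ℂ}
    (h : ∀ i j, star (X i j) = X i j) : Xᵀ = Xᴴ := by
  ext i j
  rw [transpose_apply, conjTranspose_apply, h]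

/-- The entries of `S⁺` are real. [folklore] -/
theorem star_spinRaise_apply (n : ℕ) (i j : Fin (n + 1)) :
    star (spinRaise n i j) = spinRaise n i j := by
  rw [spinRaise_apply]
  split_ifs <;> simp [Complex.conj_ofReal]

/-- The entries of `S⁻` are real. [folklore] -/
theorem star_spinLower_apply (n : ℕ) (i j : Fin (n + 1)) :
    star (spinLower n i j) = spinLower n i j := by
  rw [spinLower_apply]
  split_ifs <;> simp [Complex.conj_ofReal]

/-- `S¹ = ½(S⁺ + S⁻)` is a real matrix. [Kennedy–Lieb–Shastry, J. Stat. Phys. 53 (1988),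
before eq. (16) ("the matrices of `S¹` and `S³` have only real entries")] [folklore] -/
theorem spinX_transpose_eq (n : ℕ) : (spinX n)ᵀ = (spinX n)ᴴ := by
  refine transpose_eq_conjTranspose_of_star fun i j => ?_
  have h2 : star (1 / 2 : ℂ) = 1 / 2 := by
    rw [Complex.star_def, map_div₀, map_one, map_ofNat]
  rw [spinX, Matrix.smul_apply, Matrix.add_apply, smul_eq_mul, star_mul', star_add,
    star_spinRaise_apply, star_spinLower_apply, h2]

/-- `T² = iS² = ½(S⁺ - S⁻)`. [Kennedy–Lieb–Shastry, J. Stat. Phys. 53 (1988), before eq. (16)]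
[folklore] -/
theorem I_smul_spinY (n : ℕ) : Complex.I • spinY n = (1 / 2 : ℂ) • (spinRaise n - spinLower n) := by
  rw [spinY, smul_smul]
  congr 1
  have hI : Complex.I ≠ 0 := Complex.I_ne_zero
  field_simp

/-- `T² = iS²` is a real matrix ("`S²` has only purely imaginary entries").
[Kennedy–Lieb–Shastry, J. Stat. Phys. 53 (1988), before eq. (16)] [folklore] -/
theorem I_smul_spinY_transpose_eq (n : ℕ) : (Complex.I • spinY n)ᵀ = (Complex.I • spinY n)ᴴ := by
  rw [I_smul_spinY]
  refine transpose_eq_conjTranspose_of_star fun i j => ?_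
  have h2 : star (1 / 2 : ℂ) = 1 / 2 := by
    rw [Complex.star_def, map_div₀, map_one, map_ofNat]
  rw [Matrix.smul_apply, Matrix.sub_apply, smul_eq_mul, star_mul', star_sub,
    star_spinRaise_apply, star_spinLower_apply, h2]

/-- `S¹_x` is a real matrix. [folklore] -/
theorem siteSpin_zero_transpose_eq (n : ℕ) (x : Λ) :
    (siteSpin n x 0 : Op Λ (n + 1))ᵀ = (siteSpin n x 0)ᴴ := by
  rw [siteSpin, spinVec_zero]
  exact transpose_eq_conjTranspose_onSite x (spinX_transpose_eq n)

/-- `iS²_x` is a real matrix. [folklore] -/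
theorem I_smul_siteSpin_one_transpose_eq (n : ℕ) (x : Λ) :
    (Complex.I • (siteSpin n x 1 : Op Λ (n + 1)))ᵀ = (Complex.I • siteSpin n x 1)ᴴ := by
  rw [siteSpin, spinVec_one, ← onSite_smul']
  exact transpose_eq_conjTranspose_onSite x (I_smul_spinY_transpose_eq n)

/-- `S²_x S²_y = -(iS²_x)(iS²_y)` is a real matrix. [folklore] -/
theorem siteSpin_one_mul_transpose_eq (n : ℕ) (x y : Λ) :
    ((siteSpin n x 1 : Op Λ (n + 1)) * siteSpin n y 1)ᵀ = (siteSpin n x 1 * siteSpin n y 1)ᴴ := by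
  have h : (siteSpin n x 1 : Op Λ (n + 1)) * siteSpin n y 1 =
      -((Complex.I • siteSpin n x 1) * (Complex.I • siteSpin n y 1)) := by
    rw [smul_mul_smul_comm, Complex.I_mul_I, neg_smul, one_smul, neg_neg]
  rw [h]
  exact transpose_eq_conjTranspose_neg (transpose_eq_conjTranspose_mul
    (I_smul_siteSpin_one_transpose_eq n x) (I_smul_siteSpin_one_transpose_eq n y))

/-- The rotated bond term `τ_h(x,y)` is a real matrix. [Kennedy–Lieb–Shastry, J. Stat. Phys.
53 (1988), after eq. (17) ("the Hamiltonian `H(h̄)` has real matrix elements in this basis")]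
[folklore] -/
theorem xyRealBond_transpose_eq (n : ℕ) (h : Λ → ℝ) (x y : Λ) :
    (xyRealBond n h x y)ᵀ = (xyRealBond n h x y)ᴴ := by
  unfold xyRealBond spinBond
  have h0x := siteSpin_zero_transpose_eq (Λ := Λ) n x
  have h0y := siteSpin_zero_transpose_eq (Λ := Λ) n y
  refine transpose_eq_conjTranspose_add (transpose_eq_conjTranspose_sub
    (transpose_eq_conjTranspose_add (transpose_eq_conjTranspose_neg ?_) ?_) ?_) ?_
  · rw [show (1 / 2 : ℂ) = ((1 / 2 : ℝ) : ℂ) by push_cast; ring]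
    exact transpose_eq_conjTranspose_ofReal_smul (transpose_eq_conjTranspose_add
      (transpose_eq_conjTranspose_mul h0x h0y) (transpose_eq_conjTranspose_mul h0y h0x)) _
  · rw [show (1 / 2 : ℂ) = ((1 / 2 : ℝ) : ℂ) by push_cast; ring]
    exact transpose_eq_conjTranspose_ofReal_smul (transpose_eq_conjTranspose_add
      (siteSpin_one_mul_transpose_eq n x y) (siteSpin_one_mul_transpose_eq n y x)) _
  · exact transpose_eq_conjTranspose_ofReal_smul (transpose_eq_conjTranspose_sub h0x h0y) _
  · exact transpose_eq_conjTranspose_ofReal_smul transpose_eq_conjTranspose_one _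

/-- The rotated bond term is symmetric in the two sites. [folklore] -/
theorem xyRealBond_comm (n : ℕ) (h : Λ → ℝ) (x y : Λ) : xyRealBond n h x y = xyRealBond n h y x := by
  simp only [xyRealBond, spinBond_comm n _ x y]
  congr 2
  · rw [← neg_sub (h y) (h x), Complex.ofReal_neg, neg_smul, ← smul_neg, neg_sub]
  · rw [← neg_sub (h y) (h x), neg_sq]

/-- The rotated bond term depends on the field only through its values at the two sites.
[folklore] -/
theorem xyRealBond_congr (n : ℕ) {h₁ h₂ : Λ → ℝ} {x y : Λ} (hx : h₁ x = h₂ x) (hy : h₁ y = h₂ y) :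
    xyRealBond n h₁ x y = xyRealBond n h₂ x y := by
  simp only [xyRealBond, hx, hy]

/-- The rotated bond term is Hermitian. [folklore] -/
theorem xyRealBond_isHermitian (n : ℕ) (h : Λ → ℝ) (x y : Λ) :
    (xyRealBond n h x y).IsHermitian := by
  unfold xyRealBond
  have hr : ∀ r : ℝ, IsSelfAdjoint (r : ℂ) := fun r => by
    rw [isSelfAdjoint_iff, Complex.star_def, Complex.conj_ofReal]
  refine (((spinBond_isHermitian n 0 x y).neg.add (spinBond_isHermitian n 1 x y)).sub
    (((siteSpin_isHermitian n x 0).sub (siteSpin_isHermitian n y 0)).smul (hr _))).add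
    (isHermitian_one.smul (hr _))

end RealSpin

/-! ### The two halves of the even torus -/

section Geometry

variable (L : ℕ) [NeZero L] (j : Fin d) (a : ZMod L)

/-- `torusToLeft` on the left half is the inclusion. [folklore] -/
theorem torusToLeft_of_mem (hL : Even L) {x : TorusSite d L} (hx : x ∈ torusLeftHalf L j a) :
    torusToLeft L j a hL x = ⟨x, hx⟩ := by
  simp [torusToLeft, hx]

/-- `torusToLeft` on the right half is the reflection. [folklore] -/
theorem torusToLeft_of_not_mem (hL : Even L) {x : TorusSite d L} (hx : x ∉ torusLeftHalf L j a) :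
    torusToLeft L j a hL x =
      ⟨Torus.reflectBetweenSites j a x, (reflectBetweenSites_mem_torusLeftHalf_iff L j a hL x).2 hx⟩ := by
  simp [torusToLeft, hx]

/-- `torusToLeft ∘ θ = torusToLeft`. [folklore] -/
theorem torusToLeft_reflectBetweenSites (hL : Even L) (x : TorusSite d L) :
    torusToLeft L j a hL (Torus.reflectBetweenSites j a x) = torusToLeft L j a hL x := by
  by_cases hx : x ∈ torusLeftHalf L j a
  · have hx' : Torus.reflectBetweenSites j a x ∉ torusLeftHalf L j a := fun h' =>
      (reflectBetweenSites_mem_torusLeftHalf_iff L j a hL x).1 h' hx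
    rw [torusToLeft_of_not_mem L j a hL hx', torusToLeft_of_mem L j a hL hx]
    simp only [reflectBetweenSites_reflectBetweenSites]
  · rw [torusToLeft_of_not_mem L j a hL hx,
      torusToLeft_of_mem L j a hL ((reflectBetweenSites_mem_torusLeftHalf_iff L j a hL x).2 hx)]

/-- The value of `torusToLeft x` as a site, for `x` in the left half. [folklore] -/
theorem torusToLeft_val_of_mem (hL : Even L) {x : TorusSite d L} (hx : x ∈ torusLeftHalf L j a) :
    (torusToLeft L j a hL x : TorusSite d L) = x := by
  rw [torusToLeft_of_mem L j a hL hx]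

variable {q : ℕ}

/-- The tensor-square identification on configurations, first component. [folklore] -/
@[simp] theorem torusSplit_apply_fst (hL : Even L) (σ : TensorIndex (TorusSite d L) q)
    (s : torusLeftHalf L j a) : (torusSplit L j a hL σ).1 s = σ s := rfl

/-- The tensor-square identification on configurations, second component. [folklore] -/
@[simp] theorem torusSplit_apply_snd (hL : Even L) (σ : TensorIndex (TorusSite d L) q)
    (s : torusLeftHalf L j a) : (torusSplit L j a hL σ).2 s = σ (Torus.reflectBetweenSites j a s) := rfl

/-- The tensor-square identification on configurations, first component as a function.
[folklore] -/
theorem torusSplit_fst_eq (hL : Even L) (σ : TensorIndex (TorusSite d L) q) :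
    (torusSplit L j a hL σ).1 = fun s : torusLeftHalf L j a => σ s := rfl

/-- The tensor-square identification on configurations, second component as a function.
[folklore] -/
theorem torusSplit_snd_eq (hL : Even L) (σ : TensorIndex (TorusSite d L) q) :
    (torusSplit L j a hL σ).2 = fun s : torusLeftHalf L j a => σ (Torus.reflectBetweenSites j a s) := rfl

/-- Two configurations agree off `x` iff their left parts agree off `x` and their right parts
agree (for `x` in the left half). [folklore] -/
theorem forall_ne_iff_of_mem (hL : Even L) {x : TorusSite d L} (hx : x ∈ torusLeftHalf L j a)
    (σ τ : TensorIndex (TorusSite d L) q) :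
    (∀ y, y ≠ x → σ y = τ y) ↔
      (∀ s : torusLeftHalf L j a, s ≠ ⟨x, hx⟩ → σ s = τ s) ∧
        ∀ s : torusLeftHalf L j a, σ (Torus.reflectBetweenSites j a s) = τ (Torus.reflectBetweenSites j a s) := by
  constructor
  · intro h
    refine ⟨fun s hs => h s fun h' => hs (Subtype.ext h'), fun s => h _ fun h' => ?_⟩
    have hs' : Torus.reflectBetweenSites j a s ∉ torusLeftHalf L j a := fun hm =>
      (reflectBetweenSites_mem_torusLeftHalf_iff L j a hL (s : TorusSite d L)).1 hm s.2
    exact hs' (h' ▸ hx)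
  · rintro ⟨h1, h2⟩ y hy
    by_cases hy' : y ∈ torusLeftHalf L j a
    · exact h1 ⟨y, hy'⟩ fun h' => hy (congrArg Subtype.val h')
    · have h := h2 ⟨Torus.reflectBetweenSites j a y, (reflectBetweenSites_mem_torusLeftHalf_iff L j a hL y).2 hy'⟩
      simpa only [reflectBetweenSites_reflectBetweenSites] using h

/-- Two configurations agree off `θx` iff their left parts agree and their right parts agree
off `x` (for `x` in the left half). [folklore] -/
theorem forall_ne_reflect_iff_of_mem (hL : Even L) {x : TorusSite d L}
    (hx : x ∈ torusLeftHalf L j a) (σ τ : TensorIndex (TorusSite d L) q) :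
    (∀ y, y ≠ Torus.reflectBetweenSites j a x → σ y = τ y) ↔
      (∀ s : torusLeftHalf L j a, σ s = τ s) ∧
        ∀ s : torusLeftHalf L j a, s ≠ ⟨x, hx⟩ →
          σ (Torus.reflectBetweenSites j a s) = τ (Torus.reflectBetweenSites j a s) := by
  have hx' : Torus.reflectBetweenSites j a x ∉ torusLeftHalf L j a := fun hm =>
    (reflectBetweenSites_mem_torusLeftHalf_iff L j a hL x).1 hm hx
  constructor
  · intro h
    refine ⟨fun s => h s fun h' => hx' (h' ▸ s.2), fun s hs => h _ fun h' => hs (Subtype.ext ?_)⟩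
    have := congrArg (Torus.reflectBetweenSites j a) h'
    simpa only [reflectBetweenSites_reflectBetweenSites] using this
  · rintro ⟨h1, h2⟩ y hy
    by_cases hy' : y ∈ torusLeftHalf L j a
    · exact h1 ⟨y, hy'⟩
    · have hne : (⟨Torus.reflectBetweenSites j a y, (reflectBetweenSites_mem_torusLeftHalf_iff L j a hL y).2 hy'⟩ :
          torusLeftHalf L j a) ≠ ⟨x, hx⟩ := by
        intro h'
        have h'' := congrArg Subtype.val h'
        simp only at h''
        exact hy (by rw [← h'', reflectBetweenSites_reflectBetweenSites])
      have h := h2 _ hne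
      simpa only [reflectBetweenSites_reflectBetweenSites] using h

/-- **Single-site operators on the left half are `a_x ⊗ 1`** under the tensor-square
identification. [Kennedy–Lieb–Shastry, J. Stat. Phys. 53 (1988), p. 1028 (the matrices
`X^{L,i}`)] [folklore] -/
theorem onSite_eq_submatrix_kronecker_of_mem (hL : Even L) {x : TorusSite d L}
    (hx : x ∈ torusLeftHalf L j a) (b : Matrix (Fin q) (Fin q) ℂ) :
    (onSite x b : Op (TorusSite d L) q) =
      ((onSite (torusToLeft L j a hL x) b : Op (torusLeftHalf L j a) q) ⊗ₖ
          (1 : Op (torusLeftHalf L j a) q)).submatrix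
        (torusSplit L j a hL) (torusSplit L j a hL) := by
  ext σ τ
  rw [submatrix_apply, onSite_apply, torusToLeft_of_mem L j a hL hx]
  change _ = ((onSite _ b : Op (torusLeftHalf L j a) q) ⊗ₖ (1 : Op (torusLeftHalf L j a) q))
    ((torusSplit L j a hL σ).1, (torusSplit L j a hL σ).2)
    ((torusSplit L j a hL τ).1, (torusSplit L j a hL τ).2)
  rw [kroneckerMap_apply, onSite_apply, Matrix.one_apply, torusSplit_snd_eq, torusSplit_snd_eq]
  dsimp only [torusSplit_apply_fst]
  rw [if_congr (forall_ne_iff_of_mem L j a hL hx σ τ) rfl rfl]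
  by_cases hA : ∀ s : torusLeftHalf L j a, s ≠ ⟨x, hx⟩ → σ s = τ s <;>
    by_cases hB : ∀ s : torusLeftHalf L j a, σ (Torus.reflectBetweenSites j a s) = τ (Torus.reflectBetweenSites j a s)
  · rw [if_pos ⟨hA, hB⟩, if_pos hA, if_pos (funext hB), mul_one]
  · rw [if_neg (fun h => hB h.2), if_neg (fun h => hB fun s => congrFun h s), mul_zero]
  · rw [if_neg (fun h => hA h.1), if_neg hA, zero_mul]
  · rw [if_neg (fun h => hA h.1), if_neg hA, zero_mul]

/-- **Single-site operators on the right half are `1 ⊗ a_x`** under the tensor-square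
identification (the right factor read through `θ`). [Kennedy–Lieb–Shastry, J. Stat. Phys. 53
(1988), p. 1028 (the matrices `X^{R,i}`)] [folklore] -/
theorem onSite_reflect_eq_submatrix_kronecker_of_mem (hL : Even L) {x : TorusSite d L}
    (hx : x ∈ torusLeftHalf L j a) (b : Matrix (Fin q) (Fin q) ℂ) :
    (onSite (Torus.reflectBetweenSites j a x) b : Op (TorusSite d L) q) =
      ((1 : Op (torusLeftHalf L j a) q) ⊗ₖ
          (onSite (torusToLeft L j a hL x) b : Op (torusLeftHalf L j a) q)).submatrix
        (torusSplit L j a hL) (torusSplit L j a hL) := by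
  ext σ τ
  rw [submatrix_apply, onSite_apply, torusToLeft_of_mem L j a hL hx]
  change _ = ((1 : Op (torusLeftHalf L j a) q) ⊗ₖ (onSite _ b : Op (torusLeftHalf L j a) q))
    ((torusSplit L j a hL σ).1, (torusSplit L j a hL σ).2)
    ((torusSplit L j a hL τ).1, (torusSplit L j a hL τ).2)
  rw [kroneckerMap_apply, onSite_apply, Matrix.one_apply, torusSplit_fst_eq, torusSplit_fst_eq]
  dsimp only [torusSplit_apply_snd]
  rw [if_congr (forall_ne_reflect_iff_of_mem L j a hL hx σ τ) rfl rfl]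
  by_cases hA : ∀ s : torusLeftHalf L j a, σ s = τ s <;>
    by_cases hB : ∀ s : torusLeftHalf L j a, s ≠ ⟨x, hx⟩ →
      σ (Torus.reflectBetweenSites j a s) = τ (Torus.reflectBetweenSites j a s)
  · rw [if_pos ⟨hA, hB⟩, if_pos (funext hA), if_pos hB, one_mul]
  · rw [if_neg (fun h => hB h.2), if_neg hB, mul_zero]
  · rw [if_neg (fun h => hA h.1), if_neg (fun h => hA fun s => congrFun h s), zero_mul]
  · rw [if_neg (fun h => hA h.1), if_neg (fun h => hA fun s => congrFun h s), zero_mul]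

/-- Single-site operators on the right half, stated for a right site `z`. [folklore] -/
theorem onSite_eq_submatrix_kronecker_of_not_mem (hL : Even L) {z : TorusSite d L}
    (hz : z ∉ torusLeftHalf L j a) (b : Matrix (Fin q) (Fin q) ℂ) :
    (onSite z b : Op (TorusSite d L) q) =
      ((1 : Op (torusLeftHalf L j a) q) ⊗ₖ
          (onSite (torusToLeft L j a hL z) b : Op (torusLeftHalf L j a) q)).submatrix
        (torusSplit L j a hL) (torusSplit L j a hL) := by
  have hz' : Torus.reflectBetweenSites j a z ∈ torusLeftHalf L j a :=
    (reflectBetweenSites_mem_torusLeftHalf_iff L j a hL z).2 hz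
  have h := onSite_reflect_eq_submatrix_kronecker_of_mem L j a hL hz' b
  rwa [reflectBetweenSites_reflectBetweenSites, torusToLeft_reflectBetweenSites] at h

end Geometry


section Embeddings

variable (L : ℕ) [NeZero L] (j : Fin d) (a : ZMod L) {q : ℕ} (hL : Even L)

/-- Unfolding `torusLeftEmbed`. [folklore] -/
theorem torusLeftEmbed_apply (A : Op (torusLeftHalf L j a) q) :
    torusLeftEmbed L j a hL A =
      (A ⊗ₖ (1 : Op (torusLeftHalf L j a) q)).submatrix (torusSplit L j a hL)
        (torusSplit L j a hL) := rfl

/-- Unfolding `torusRightEmbed`. [folklore] -/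
theorem torusRightEmbed_apply (B : Op (torusLeftHalf L j a) q) :
    torusRightEmbed L j a hL B =
      ((1 : Op (torusLeftHalf L j a) q) ⊗ₖ B).submatrix (torusSplit L j a hL)
        (torusSplit L j a hL) := rfl

/-- `(A ⊗ 1)(1 ⊗ B) = A ⊗ B` on the torus. [folklore] -/
theorem torusLeftEmbed_mul_torusRightEmbed (A B : Op (torusLeftHalf L j a) q) :
    torusLeftEmbed L j a hL A * torusRightEmbed L j a hL B =
      (A ⊗ₖ B).submatrix (torusSplit L j a hL) (torusSplit L j a hL) := by
  rw [torusLeftEmbed_apply, torusRightEmbed_apply, submatrix_mul_equiv, ← mul_kronecker_mul,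
    Matrix.mul_one, Matrix.one_mul]

/-- `(1 ⊗ B)(A ⊗ 1) = A ⊗ B` on the torus: the two halves commute. [folklore] -/
theorem torusRightEmbed_mul_torusLeftEmbed (A B : Op (torusLeftHalf L j a) q) :
    torusRightEmbed L j a hL B * torusLeftEmbed L j a hL A =
      (A ⊗ₖ B).submatrix (torusSplit L j a hL) (torusSplit L j a hL) := by
  rw [torusLeftEmbed_apply, torusRightEmbed_apply, submatrix_mul_equiv, ← mul_kronecker_mul,
    Matrix.mul_one, Matrix.one_mul]

/-- **The Kronecker form, pulled back**: `(A ⊗ 1 + 1 ⊗ B - Σᵢ Mᵢ ⊗ Nᵢ)` on configurations of the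
torus is `ι_L A + ι_R B - Σᵢ ι_L Mᵢ · ι_R Nᵢ`. [Kennedy–Lieb–Shastry, J. Stat. Phys. 53 (1988),
eq. (21)] [folklore] -/
theorem submatrix_kroneckerForm {ι : Type*} (s : Finset ι) (A B : Op (torusLeftHalf L j a) q)
    (M N : ι → Op (torusLeftHalf L j a) q) :
    (A ⊗ₖ (1 : Op (torusLeftHalf L j a) q) + (1 : Op (torusLeftHalf L j a) q) ⊗ₖ B -
        ∑ i ∈ s, M i ⊗ₖ N i).submatrix (torusSplit L j a hL) (torusSplit L j a hL) =
      torusLeftEmbed L j a hL A + torusRightEmbed L j a hL B -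
        ∑ i ∈ s, torusLeftEmbed L j a hL (M i) * torusRightEmbed L j a hL (N i) := by
  simp only [torusLeftEmbed_mul_torusRightEmbed]
  simp only [torusLeftEmbed_apply, torusRightEmbed_apply, submatrix_sub, submatrix_add,
    Pi.sub_apply, Pi.add_apply]
  congr 1
  ext σ τ
  simp only [submatrix_apply, Matrix.sum_apply]

variable {L j a hL}

/-- Single-site spin operators of the left half. [folklore] -/
theorem siteSpin_eq_torusLeftEmbed (n : ℕ) {x : TorusSite d L} (hx : x ∈ torusLeftHalf L j a)
    (α : Fin 3) :
    (siteSpin n x α : Op (TorusSite d L) (n + 1)) =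
      torusLeftEmbed L j a hL (siteSpin n (torusToLeft L j a hL x) α) := by
  rw [siteSpin, siteSpin, torusLeftEmbed_apply]
  exact onSite_eq_submatrix_kronecker_of_mem L j a hL hx _

/-- Single-site spin operators of the right half. [folklore] -/
theorem siteSpin_eq_torusRightEmbed (n : ℕ) {z : TorusSite d L} (hz : z ∉ torusLeftHalf L j a)
    (α : Fin 3) :
    (siteSpin n z α : Op (TorusSite d L) (n + 1)) =
      torusRightEmbed L j a hL (siteSpin n (torusToLeft L j a hL z) α) := by
  rw [siteSpin, siteSpin, torusRightEmbed_apply]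
  exact onSite_eq_submatrix_kronecker_of_not_mem L j a hL hz _

/-- Pushing an algebra homomorphism through the rotated bond term. [folklore] -/
theorem map_xyRealBond {Λ Λ' : Type*} [Fintype Λ] [DecidableEq Λ] [Fintype Λ'] [DecidableEq Λ']
    (n : ℕ) (φ : Op Λ (n + 1) →ₐ[ℂ] Op Λ' (n + 1)) (h : Λ → ℝ) (x y : Λ) :
    φ (xyRealBond n h x y) =
      -((1 / 2 : ℂ) • (φ (siteSpin n x 0) * φ (siteSpin n y 0) +
          φ (siteSpin n y 0) * φ (siteSpin n x 0))) +
        (1 / 2 : ℂ) • (φ (siteSpin n x 1) * φ (siteSpin n y 1) +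
          φ (siteSpin n y 1) * φ (siteSpin n x 1)) -
        ((h x - h y : ℝ) : ℂ) • (φ (siteSpin n x 0) - φ (siteSpin n y 0)) +
        (((h x - h y) ^ 2 / 2 : ℝ) : ℂ) • 1 := by
  simp only [xyRealBond, spinBond, map_add, map_sub, map_neg, map_smul, map_mul, map_one]

/-- **Left bonds are `τ ⊗ 1`.** [Kennedy–Lieb–Shastry, J. Stat. Phys. 53 (1988), eq. (21)
(the terms of `H^L`)] [folklore] -/
theorem xyRealBond_eq_torusLeftEmbed (n : ℕ) (g : TorusSite d L → ℝ) {x y : TorusSite d L}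
    (hx : x ∈ torusLeftHalf L j a) (hy : y ∈ torusLeftHalf L j a) :
    xyRealBond n g x y = torusLeftEmbed L j a hL
      (xyRealBond n (fun s : torusLeftHalf L j a => g s)
        (torusToLeft L j a hL x) (torusToLeft L j a hL y)) := by
  rw [map_xyRealBond, ← siteSpin_eq_torusLeftEmbed n hx, ← siteSpin_eq_torusLeftEmbed n hy,
    ← siteSpin_eq_torusLeftEmbed n hx, ← siteSpin_eq_torusLeftEmbed n hy,
    torusToLeft_val_of_mem L j a hL hx, torusToLeft_val_of_mem L j a hL hy]
  rfl

/-- **Right bonds are `1 ⊗ τ`** (with the reflected field). [Kennedy–Lieb–Shastry, J. Stat.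
Phys. 53 (1988), eq. (21) (the terms of `H^R`)] [folklore] -/
theorem xyRealBond_eq_torusRightEmbed (n : ℕ) (g : TorusSite d L → ℝ) {z w : TorusSite d L}
    (hz : z ∉ torusLeftHalf L j a) (hw : w ∉ torusLeftHalf L j a) :
    xyRealBond n g z w = torusRightEmbed L j a hL
      (xyRealBond n (fun s : torusLeftHalf L j a => g (Torus.reflectBetweenSites j a s))
        (torusToLeft L j a hL z) (torusToLeft L j a hL w)) := by
  rw [map_xyRealBond, ← siteSpin_eq_torusRightEmbed n hz, ← siteSpin_eq_torusRightEmbed n hw,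
    ← siteSpin_eq_torusRightEmbed n hz, ← siteSpin_eq_torusRightEmbed n hw,
    torusToLeft_of_not_mem L j a hL hz, torusToLeft_of_not_mem L j a hL hw]
  simp only [reflectBetweenSites_reflectBetweenSites]
  rfl

/-- Membership in the crossing sites, unfolded. [folklore] -/
theorem mem_torusCrossSites {x : TorusSite d L} :
    x ∈ torusCrossSites L j a ↔
      x ∈ torusLeftHalf L j a ∧ (torusGraph d L).Adj x (Torus.reflectBetweenSites j a x) := by
  simp [torusCrossSites]

/-- **Crossing bonds**: for a left endpoint `x` of a crossing bond `{x, θx}`,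
`τ_g(x, θx) = (½g_x² - g_x T¹_x) ⊗ 1 + 1 ⊗ (½g_{θx}² - g_{θx} T¹_x) - (T¹_x - g_x) ⊗ (T¹_x - g_{θx})
- T²_x ⊗ T²_x` (eq. (20) of Kennedy–Lieb–Shastry, J. Stat. Phys. 53 (1988), XY version).
[cite: KLS1988JSP, eqs. (20)–(21)] -/
theorem xyRealBond_cross (n : ℕ) (g : TorusSite d L → ℝ) (x : torusCrossSites L j a) :
    xyRealBond n g x (Torus.reflectBetweenSites j a x) =
      torusLeftEmbed L j a hL ((((g x) ^ 2 / 2 : ℝ) : ℂ) • 1 -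
          ((g x : ℝ) : ℂ) • siteSpin n (torusToLeft L j a hL x) 0) +
        torusRightEmbed L j a hL ((((g (Torus.reflectBetweenSites j a x)) ^ 2 / 2 : ℝ) : ℂ) • 1 -
          ((g (Torus.reflectBetweenSites j a x) : ℝ) : ℂ) • siteSpin n (torusToLeft L j a hL x) 0) -
        (torusLeftEmbed L j a hL (xyCrossOp L j a hL n g (x, true)) *
            torusRightEmbed L j a hL
              (xyCrossOp L j a hL n (fun y => g (Torus.reflectBetweenSites j a y)) (x, true)) +
          torusLeftEmbed L j a hL (xyCrossOp L j a hL n g (x, false)) *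
            torusRightEmbed L j a hL
              (xyCrossOp L j a hL n (fun y => g (Torus.reflectBetweenSites j a y)) (x, false))) := by
  have hx : (x : TorusSite d L) ∈ torusLeftHalf L j a := (mem_torusCrossSites.1 x.2).1
  have hθ : Torus.reflectBetweenSites j a x ∉ torusLeftHalf L j a := fun h =>
    (reflectBetweenSites_mem_torusLeftHalf_iff L j a hL (x : TorusSite d L)).1 h hx
  have e0 : (siteSpin n (x : TorusSite d L) 0 : Op (TorusSite d L) (n + 1)) =
      torusLeftEmbed L j a hL (siteSpin n (torusToLeft L j a hL x) 0) :=
    siteSpin_eq_torusLeftEmbed n hx 0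
  have e1 : (siteSpin n (x : TorusSite d L) 1 : Op (TorusSite d L) (n + 1)) =
      torusLeftEmbed L j a hL (siteSpin n (torusToLeft L j a hL x) 1) :=
    siteSpin_eq_torusLeftEmbed n hx 1
  have e2 : (siteSpin n (Torus.reflectBetweenSites j a x) 0 : Op (TorusSite d L) (n + 1)) =
      torusRightEmbed L j a hL (siteSpin n (torusToLeft L j a hL x) 0) := by
    rw [siteSpin_eq_torusRightEmbed n hθ, torusToLeft_reflectBetweenSites]
  have e3 : (siteSpin n (Torus.reflectBetweenSites j a x) 1 : Op (TorusSite d L) (n + 1)) =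
      torusRightEmbed L j a hL (siteSpin n (torusToLeft L j a hL x) 1) := by
    rw [siteSpin_eq_torusRightEmbed n hθ, torusToLeft_reflectBetweenSites]
  -- atoms
  set X : Op (torusLeftHalf L j a) (n + 1) := siteSpin n (torusToLeft L j a hL x) 0 with hX
  set Y : Op (torusLeftHalf L j a) (n + 1) := siteSpin n (torusToLeft L j a hL x) 1 with hY
  clear_value X Y
  have hPX : torusLeftEmbed L j a hL X * torusRightEmbed L j a hL X =
      torusRightEmbed L j a hL X * torusLeftEmbed L j a hL X := by
    rw [torusLeftEmbed_mul_torusRightEmbed, torusRightEmbed_mul_torusLeftEmbed]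
  have hPY : torusLeftEmbed L j a hL Y * torusRightEmbed L j a hL Y =
      torusRightEmbed L j a hL Y * torusLeftEmbed L j a hL Y := by
    rw [torusLeftEmbed_mul_torusRightEmbed, torusRightEmbed_mul_torusLeftEmbed]
  simp only [xyRealBond, spinBond, xyCrossOp, map_sub, map_smul, map_one]
  simp only [e0, e1, e2, e3]
  simp only [← hX, ← hY]
  simp only [mul_sub, sub_mul, smul_mul_assoc, mul_smul_comm, Matrix.one_mul, Matrix.mul_one,
    smul_sub, smul_smul, Complex.I_mul_I]
  rw [← hPX, ← hPY]
  push_cast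
  module

end Embeddings


/-! ### Geometry of the reflection: bonds -/

section BondGeometry

variable (L : ℕ) [NeZero L] (j : Fin d) (a : ZMod L)

omit [NeZero L] in
/-- `θ(x + eᵢ) = θx + eᵢ` for `i ≠ j`. [folklore] -/
theorem reflectBetweenSites_add_single_of_ne (x : TorusSite d L) {i : Fin d} (hi : i ≠ j) :
    Torus.reflectBetweenSites j a (x + Pi.single i 1) = Torus.reflectBetweenSites j a x + Pi.single i 1 := by
  ext k
  by_cases hk : k = j
  · subst hk
    simp [Torus.reflectBetweenSites_apply, Ne.symm hi]
  · simp [Torus.reflectBetweenSites_apply, hk]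

omit [NeZero L] in
/-- `θ(x + eⱼ) = θx - eⱼ`. [folklore] -/
theorem reflectBetweenSites_add_single_self (x : TorusSite d L) :
    Torus.reflectBetweenSites j a (x + Pi.single j 1) = Torus.reflectBetweenSites j a x - Pi.single j 1 := by
  ext k
  by_cases hk : k = j
  · subst hk
    simp [Torus.reflectBetweenSites_apply]
    ring
  · simp [Torus.reflectBetweenSites_apply, hk]

omit [NeZero L] in
/-- `θ` is a graph automorphism of the torus (Dyson–Lieb–Simon 1978, §2). [folklore] -/
theorem torusGraph_adj_reflectBetweenSites (x y : TorusSite d L) :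
    (torusGraph d L).Adj (Torus.reflectBetweenSites j a x) (Torus.reflectBetweenSites j a y) ↔ (torusGraph d L).Adj x y := by
  have key : ∀ x y : TorusSite d L, (torusGraph d L).Adj x y →
      (torusGraph d L).Adj (Torus.reflectBetweenSites j a x) (Torus.reflectBetweenSites j a y) := by
    intro x y h
    rw [torusGraph_adj_iff] at h ⊢
    refine ⟨fun h' => h.1 ((Torus.reflectBetweenSites j a).injective h'), ?_⟩
    rcases h.2 with ⟨i, rfl⟩ | ⟨i, rfl⟩
    · by_cases hi : i = j
      · subst hi
        right
        exact ⟨i, by rw [reflectBetweenSites_add_single_self, sub_add_cancel]⟩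
      · left
        exact ⟨i, reflectBetweenSites_add_single_of_ne L j a x hi⟩
    · by_cases hi : i = j
      · subst hi
        left
        exact ⟨i, by rw [reflectBetweenSites_add_single_self, sub_add_cancel]⟩
      · right
        exact ⟨i, reflectBetweenSites_add_single_of_ne L j a y hi⟩
  refine ⟨fun h => ?_, key x y⟩
  have h' := key _ _ h
  rwa [reflectBetweenSites_reflectBetweenSites, reflectBetweenSites_reflectBetweenSites] at h'

/-- The image of an edge under `θ` is an edge. [folklore] -/
theorem map_reflectBetweenSites_mem_edgeFinset {e : Sym2 (TorusSite d L)} :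
    e.map (Torus.reflectBetweenSites j a) ∈ (torusGraph d L).edgeFinset ↔ e ∈ (torusGraph d L).edgeFinset := by
  induction e using Sym2.ind with
  | h x y =>
    rw [Sym2.map_mk, SimpleGraph.mem_edgeFinset, SimpleGraph.mem_edgeSet,
      SimpleGraph.mem_edgeFinset, SimpleGraph.mem_edgeSet, torusGraph_adj_reflectBetweenSites]

omit [NeZero L] in
/-- `θ ∘ θ = id` on unordered pairs. [folklore] -/
theorem map_reflectBetweenSites_map_reflectBetweenSites (e : Sym2 (TorusSite d L)) :
    (e.map (Torus.reflectBetweenSites j a)).map (Torus.reflectBetweenSites j a) = e := by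
  induction e using Sym2.ind with
  | h x y => rw [Sym2.map_mk, Sym2.map_mk, reflectBetweenSites_reflectBetweenSites, reflectBetweenSites_reflectBetweenSites]

/-- **A bond crossing the planes `P` is `{x, θx}`**: if `x` is in the left half, `y` is not,
and `x ~ y`, then `y = θx` (even `L`). [Kennedy–Lieb–Shastry, J. Stat. Phys. 53 (1988),
p. 1028; Dyson–Lieb–Simon 1978, §2] [folklore] -/
theorem eq_reflectBetweenSites_of_adj (hL : Even L) {x y : TorusSite d L} (hx : x ∈ torusLeftHalf L j a)
    (hy : y ∉ torusLeftHalf L j a) (hadj : (torusGraph d L).Adj x y) :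
    y = Torus.reflectBetweenSites j a x := by
  obtain ⟨k, hk⟩ := hL
  have hL0 : 0 < L := Nat.pos_of_ne_zero (NeZero.ne L)
  haveI : Fact (1 < L) := ⟨by omega⟩
  have hk2 : L / 2 = k := by omega
  rw [mem_torusLeftHalf] at hx hy
  set t : ZMod L := x j - (a + 1) with ht
  have hxt : x j = t + (a + 1) := by rw [ht, sub_add_cancel]
  have htv : t.val < L := ZMod.val_lt t
  rw [torusGraph_adj_iff] at hadj
  obtain ⟨hne, ⟨i, rfl⟩ | ⟨i, hxy⟩⟩ := hadj
  · -- `y = x + eᵢ`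
    by_cases hij : i = j
    · subst hij
      have hyj : (x + Pi.single i 1 : TorusSite d L) i - (a + 1) = t + 1 := by
        rw [Pi.add_apply, Pi.single_eq_same, ht]; ring
      rw [hyj] at hy
      have hval : (t + 1).val = t.val + 1 := by
        rw [ZMod.val_add_of_lt, ZMod.val_one]
        · rw [ZMod.val_one]; omega
      rw [hval] at hy
      have htk : t.val + 1 = L / 2 := by omega
      have ht1 : (t + 1 : ZMod L) = ((L / 2 : ℕ) : ZMod L) := by
        apply ZMod.val_injective
        rw [hval, htk, ZMod.val_natCast, Nat.mod_eq_of_lt (by omega)]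
      have h2 : (2 : ZMod L) * (t + 1) = 0 := by
        rw [ht1, show (2 : ZMod L) = ((2 : ℕ) : ZMod L) by norm_cast, ← Nat.cast_mul,
          Nat.two_mul_div_two_of_even ⟨k, hk⟩, ZMod.natCast_self]
      ext l
      by_cases hl : l = i
      · subst hl
        rw [Pi.add_apply, Pi.single_eq_same, Torus.reflectBetweenSites_apply, Function.update_self]
        linear_combination (1 : ZMod L) * h2 + (2 : ZMod L) * hxt
      · rw [Pi.add_apply, Pi.single_eq_of_ne hl, add_zero, Torus.reflectBetweenSites_apply,
          Function.update_of_ne hl]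
    · exfalso
      apply hy
      rwa [Pi.add_apply, Pi.single_eq_of_ne (Ne.symm hij), add_zero]
  · -- `x = y + eᵢ`
    by_cases hij : i = j
    · subst hij
      have hyx : y = x - Pi.single i 1 := by rw [hxy, add_sub_cancel_right]
      have hyj : y i - (a + 1) = t - 1 := by
        rw [hyx, Pi.sub_apply, Pi.single_eq_same, ht]; ring
      rw [hyj] at hy
      have ht0 : t.val = 0 := by
        by_contra h0
        apply hy
        rw [ZMod.val_sub, ZMod.val_one]
        · omega
        · rw [ZMod.val_one]; omega
      have ht0' : t = 0 := (ZMod.val_eq_zero t).1 ht0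
      rw [hyx]
      ext l
      by_cases hl : l = i
      · subst hl
        rw [Pi.sub_apply, Pi.single_eq_same, Torus.reflectBetweenSites_apply, Function.update_self]
        linear_combination (2 : ZMod L) * ht0' + (-2 : ZMod L) * hxt
      · rw [Pi.sub_apply, Pi.single_eq_of_ne hl, sub_zero, Torus.reflectBetweenSites_apply, Function.update_of_ne hl]
    · exfalso
      apply hy
      have hyx : y j = x j := by
        rw [hxy, Pi.add_apply, Pi.single_eq_of_ne (Ne.symm hij), add_zero]
      rw [hyx]
      exact hx

/-- A crossing site gives a crossing edge `{x, θx}` of the torus graph. [folklore] -/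
theorem mk_reflectBetweenSites_mem_edgeFinset {x : TorusSite d L} (hx : x ∈ torusCrossSites L j a) :
    s(x, Torus.reflectBetweenSites j a x) ∈ (torusGraph d L).edgeFinset := by
  rw [SimpleGraph.mem_edgeFinset, SimpleGraph.mem_edgeSet]
  exact (mem_filter.1 hx).2

/-- The edges of the torus graph which are neither left nor right bonds are exactly the
crossing bonds `{x, θx}`, `x` a crossing site: reindexing sums. [Kennedy–Lieb–Shastry, J. Stat.
Phys. 53 (1988), p. 1028 ("There are three types of bonds")] [folklore] -/
theorem sum_crossEdges_eq (hL : Even L) {M : Type*} [AddCommMonoid M]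
    (f : Sym2 (TorusSite d L) → M) :
    ∑ e ∈ ((torusGraph d L).edgeFinset.filter fun e =>
        ¬ (∀ x ∈ e, x ∈ torusLeftHalf L j a) ∧ ¬ (∀ x ∈ e, x ∉ torusLeftHalf L j a)), f e =
      ∑ x ∈ torusCrossSites L j a, f s(x, Torus.reflectBetweenSites j a x) := by
  symm
  refine Finset.sum_bij (fun x _ => s(x, Torus.reflectBetweenSites j a x)) (fun x hx => ?_)
    (fun x₁ hx₁ x₂ hx₂ h => ?_) (fun e he => ?_) (fun x hx => rfl)
  · -- maps into the mixed edges
    have hxL : x ∈ torusLeftHalf L j a := (mem_filter.1 hx).1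
    have hθ : Torus.reflectBetweenSites j a x ∉ torusLeftHalf L j a := fun h =>
      (reflectBetweenSites_mem_torusLeftHalf_iff L j a hL x).1 h hxL
    refine mem_filter.2 ⟨mk_reflectBetweenSites_mem_edgeFinset L j a hx, fun h => hθ (h _ ?_),
      fun h => h _ ?_ hxL⟩
    · exact Sym2.mem_mk_right _ _
    · exact Sym2.mem_mk_left _ _
  · -- injective
    have hx₁L : x₁ ∈ torusLeftHalf L j a := (mem_filter.1 hx₁).1
    have hx₂L : x₂ ∈ torusLeftHalf L j a := (mem_filter.1 hx₂).1
    rcases Sym2.eq_iff.1 h with ⟨h1, -⟩ | ⟨h1, -⟩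
    · exact h1
    · exfalso
      exact (reflectBetweenSites_mem_torusLeftHalf_iff L j a hL x₂).1 (h1 ▸ hx₁L) hx₂L
  · -- surjective
    obtain ⟨he, hnl, hnr⟩ := mem_filter.1 he
    revert he hnl hnr
    refine Sym2.ind (fun u v => ?_) e
    intro he hnl hnr
    rw [SimpleGraph.mem_edgeFinset, SimpleGraph.mem_edgeSet] at he
    by_cases hu : u ∈ torusLeftHalf L j a
    · have hv : v ∉ torusLeftHalf L j a := by
        intro hv
        apply hnl
        intro x hx'
        rcases Sym2.mem_iff.1 hx' with rfl | rfl <;> assumption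
      have hvu := eq_reflectBetweenSites_of_adj L j a hL hu hv he
      subst hvu
      exact ⟨u, mem_filter.2 ⟨hu, he⟩, rfl⟩
    · have hv : v ∈ torusLeftHalf L j a := by
        by_contra hv
        apply hnr
        intro x hx'
        rcases Sym2.mem_iff.1 hx' with rfl | rfl <;> assumption
      have huv := eq_reflectBetweenSites_of_adj L j a hL hv hu he.symm
      subst huv
      exact ⟨v, mem_filter.2 ⟨hv, he.symm⟩, Sym2.eq_swap⟩

/-- Reflecting a right bond gives a left bond and conversely: reindexing sums over right bonds
as sums over left bonds, for summands invariant under `θ`. [Kennedy–Lieb–Shastry, J. Stat.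
Phys. 53 (1988), p. 1028] [folklore] -/
theorem sum_rightEdges_eq_sum_leftEdges (hL : Even L) {M : Type*} [AddCommMonoid M]
    (f : Sym2 (TorusSite d L) → M) (hf : ∀ e, f (e.map (Torus.reflectBetweenSites j a)) = f e) :
    ∑ e ∈ ((torusGraph d L).edgeFinset.filter fun e => ∀ x ∈ e, x ∉ torusLeftHalf L j a), f e =
      ∑ e ∈ torusLeftEdges L j a, f e := by
  refine Finset.sum_nbij' (Sym2.map (Torus.reflectBetweenSites j a)) (Sym2.map (Torus.reflectBetweenSites j a))
    (fun e he => ?_) (fun e he => ?_) (fun e _ => map_reflectBetweenSites_map_reflectBetweenSites L j a e)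
    (fun e _ => map_reflectBetweenSites_map_reflectBetweenSites L j a e) (fun e _ => (hf e).symm)
  · obtain ⟨he, hr⟩ := mem_filter.1 he
    refine mem_filter.2 ⟨(map_reflectBetweenSites_mem_edgeFinset L j a).2 he, fun x hx => ?_⟩
    obtain ⟨y, hy, rfl⟩ := Sym2.mem_map.1 hx
    exact (reflectBetweenSites_mem_torusLeftHalf_iff L j a hL y).2 (hr y hy)
  · obtain ⟨he, hl⟩ := mem_filter.1 he
    refine mem_filter.2 ⟨(map_reflectBetweenSites_mem_edgeFinset L j a).2 he, fun x hx => ?_⟩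
    obtain ⟨y, hy, rfl⟩ := Sym2.mem_map.1 hx
    intro h
    exact (reflectBetweenSites_mem_torusLeftHalf_iff L j a hL y).1 h (hl y hy)

/-- Reindexing sums over right bonds as sums over left bonds along `θ` (general summands).
[folklore] -/
theorem sum_rightEdges_eq_sum_leftEdges_map (hL : Even L) {M : Type*} [AddCommMonoid M]
    (f : Sym2 (TorusSite d L) → M) :
    ∑ e ∈ ((torusGraph d L).edgeFinset.filter fun e => ∀ x ∈ e, x ∉ torusLeftHalf L j a), f e =
      ∑ e ∈ torusLeftEdges L j a, f (e.map (Torus.reflectBetweenSites j a)) := by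
  refine Finset.sum_nbij' (Sym2.map (Torus.reflectBetweenSites j a)) (Sym2.map (Torus.reflectBetweenSites j a))
    (fun e he => ?_) (fun e he => ?_) (fun e _ => map_reflectBetweenSites_map_reflectBetweenSites L j a e)
    (fun e _ => map_reflectBetweenSites_map_reflectBetweenSites L j a e)
    (fun e _ => by rw [map_reflectBetweenSites_map_reflectBetweenSites])
  · obtain ⟨he, hr⟩ := mem_filter.1 he
    refine mem_filter.2 ⟨(map_reflectBetweenSites_mem_edgeFinset L j a).2 he, fun x hx => ?_⟩
    obtain ⟨y, hy, rfl⟩ := Sym2.mem_map.1 hx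
    exact (reflectBetweenSites_mem_torusLeftHalf_iff L j a hL y).2 (hr y hy)
  · obtain ⟨he, hl⟩ := mem_filter.1 he
    refine mem_filter.2 ⟨(map_reflectBetweenSites_mem_edgeFinset L j a).2 he, fun x hx => ?_⟩
    obtain ⟨y, hy, rfl⟩ := Sym2.mem_map.1 hx
    intro h
    exact (reflectBetweenSites_mem_torusLeftHalf_iff L j a hL y).1 h (hl y hy)

/-- Reindexing sums over left bonds as sums over right bonds along `θ` (general summands).
[folklore] -/
theorem sum_leftEdges_eq_sum_rightEdges_map (hL : Even L) {M : Type*} [AddCommMonoid M]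
    (f : Sym2 (TorusSite d L) → M) :
    ∑ e ∈ torusLeftEdges L j a, f e =
      ∑ e ∈ ((torusGraph d L).edgeFinset.filter fun e => ∀ x ∈ e, x ∉ torusLeftHalf L j a),
        f (e.map (Torus.reflectBetweenSites j a)) := by
  rw [sum_rightEdges_eq_sum_leftEdges_map L j a hL]
  refine sum_congr rfl fun e _ => ?_
  rw [map_reflectBetweenSites_map_reflectBetweenSites]

/-- Splitting a sum over the edges of the torus graph into left, right and crossing bonds.
[Kennedy–Lieb–Shastry, J. Stat. Phys. 53 (1988), p. 1028 ("There are three types of bonds")]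
[folklore] -/
theorem sum_edgeFinset_split (hL : Even L) {M : Type*} [AddCommMonoid M]
    (f : Sym2 (TorusSite d L) → M) :
    ∑ e ∈ (torusGraph d L).edgeFinset, f e =
      ∑ e ∈ torusLeftEdges L j a, f e +
        ∑ e ∈ ((torusGraph d L).edgeFinset.filter fun e => ∀ x ∈ e, x ∉ torusLeftHalf L j a), f e +
        ∑ x ∈ torusCrossSites L j a, f s(x, Torus.reflectBetweenSites j a x) := by
  rw [← sum_crossEdges_eq L j a hL, torusLeftEdges,
    ← sum_filter_add_sum_filter_not _ (fun e => ∀ x ∈ e, x ∈ torusLeftHalf L j a), add_assoc]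
  congr 1
  rw [← sum_filter_add_sum_filter_not _ (fun e : Sym2 (TorusSite d L) =>
    ∀ x ∈ e, x ∉ torusLeftHalf L j a), Finset.filter_filter, Finset.filter_filter]
  congr 1
  · apply sum_congr _ (fun _ _ => rfl)
    ext e
    simp only [mem_filter, and_congr_right_iff, and_iff_right_iff_imp]
    intro he hr hl
    -- an edge is nonempty, so it cannot be both left and right
    induction e using Sym2.ind with
    | h u v => exact hr u (Sym2.mem_mk_left u v) (hl u (Sym2.mem_mk_left u v))

end BondGeometry


section KroneckerForm

variable (L : ℕ) [NeZero L] (j : Fin d) (a : ZMod L) (hL : Even L) (n : ℕ)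

/-- **The Kronecker form of the rotated field Hamiltonian** (Kennedy–Lieb–Shastry, J. Stat.
Phys. 53 (1988), eq. (21)): under the tensor-square identification along `θ`,
`H♭(g) = H^L(g) ⊗ 1 + 1 ⊗ H^L(g ∘ θ) - Σᵢ Mᵢ(g) ⊗ Mᵢ(g ∘ θ)`. [cite: KLS1988JSP, eq. (21)] -/
theorem xyRealFieldHamiltonian_eq_submatrix (g : TorusSite d L → ℝ) :
    xyRealFieldHamiltonian L n g =
      (xyLeftHamiltonian L j a hL n g ⊗ₖ (1 : Op (torusLeftHalf L j a) (n + 1)) +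
          (1 : Op (torusLeftHalf L j a) (n + 1)) ⊗ₖ
            xyLeftHamiltonian L j a hL n (fun y => g (Torus.reflectBetweenSites j a y)) -
          ∑ i, xyCrossOp L j a hL n g i ⊗ₖ
            xyCrossOp L j a hL n (fun y => g (Torus.reflectBetweenSites j a y)) i).submatrix
        (torusSplit L j a hL) (torusSplit L j a hL) := by
  rw [submatrix_kroneckerForm, xyRealFieldHamiltonian, sum_edgeFinset_split L j a hL]
  -- names for the three half-space summands
  set TL : Sym2 (TorusSite d L) → Op (torusLeftHalf L j a) (n + 1) := fun e =>
    Sym2.lift ⟨fun x y => xyRealBond n (fun z : torusLeftHalf L j a => g z)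
      (torusToLeft L j a hL x) (torusToLeft L j a hL y),
      fun x y => xyRealBond_comm n _ _ _⟩ e with hTL
  set TR : Sym2 (TorusSite d L) → Op (torusLeftHalf L j a) (n + 1) := fun e =>
    Sym2.lift ⟨fun x y => xyRealBond n (fun z : torusLeftHalf L j a => g (Torus.reflectBetweenSites j a z))
      (torusToLeft L j a hL x) (torusToLeft L j a hL y),
      fun x y => xyRealBond_comm n _ _ _⟩ e with hTR
  -- (1) left bonds
  have h1 : ∑ e ∈ torusLeftEdges L j a,
      Sym2.lift ⟨fun x y => xyRealBond n g x y, fun x y => xyRealBond_comm n g x y⟩ e =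
        torusLeftEmbed L j a hL (∑ e ∈ torusLeftEdges L j a, TL e) := by
    rw [map_sum]
    refine sum_congr rfl fun e he => ?_
    obtain ⟨-, hl⟩ := mem_filter.1 he
    revert hl
    refine Sym2.ind (fun x y => ?_) e
    intro hl
    simp only [hTL, Sym2.lift_mk]
    exact xyRealBond_eq_torusLeftEmbed n g (hl x (Sym2.mem_mk_left x y))
      (hl y (Sym2.mem_mk_right x y))
  -- (2) right bonds
  have h2 : ∑ e ∈ ((torusGraph d L).edgeFinset.filter fun e => ∀ x ∈ e, x ∉ torusLeftHalf L j a),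
      Sym2.lift ⟨fun x y => xyRealBond n g x y, fun x y => xyRealBond_comm n g x y⟩ e =
        torusRightEmbed L j a hL (∑ e ∈ torusLeftEdges L j a, TR e) := by
    rw [← sum_rightEdges_eq_sum_leftEdges L j a hL TR, map_sum]
    · refine sum_congr rfl fun e he => ?_
      obtain ⟨-, hr⟩ := mem_filter.1 he
      revert hr
      refine Sym2.ind (fun x y => ?_) e
      intro hr
      simp only [hTR, Sym2.lift_mk]
      exact xyRealBond_eq_torusRightEmbed n g (hr x (Sym2.mem_mk_left x y))
        (hr y (Sym2.mem_mk_right x y))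
    · intro e
      refine Sym2.ind (fun x y => ?_) e
      simp only [hTR, Sym2.map_mk, Sym2.lift_mk, torusToLeft_reflectBetweenSites]
  -- (3) crossing bonds
  have h3 : ∑ x ∈ torusCrossSites L j a,
      Sym2.lift ⟨fun x y => xyRealBond n g x y, fun x y => xyRealBond_comm n g x y⟩
        s(x, Torus.reflectBetweenSites j a x) =
      torusLeftEmbed L j a hL (∑ x ∈ torusCrossSites L j a,
          ((((g x) ^ 2 / 2 : ℝ) : ℂ) • (1 : Op (torusLeftHalf L j a) (n + 1)) -
            ((g x : ℝ) : ℂ) • siteSpin n (torusToLeft L j a hL x) 0)) +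
        torusRightEmbed L j a hL (∑ x ∈ torusCrossSites L j a,
          ((((g (Torus.reflectBetweenSites j a x)) ^ 2 / 2 : ℝ) : ℂ) • (1 : Op (torusLeftHalf L j a) (n + 1)) -
            ((g (Torus.reflectBetweenSites j a x) : ℝ) : ℂ) • siteSpin n (torusToLeft L j a hL x) 0)) -
        ∑ i : torusCrossSites L j a × Bool, torusLeftEmbed L j a hL (xyCrossOp L j a hL n g i) *
          torusRightEmbed L j a hL (xyCrossOp L j a hL n (fun y => g (Torus.reflectBetweenSites j a y)) i) := by
    rw [map_sum, map_sum, Fintype.sum_prod_type]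
    simp only [Fintype.sum_bool]
    rw [← Finset.sum_coe_sort (torusCrossSites L j a), ← Finset.sum_coe_sort (torusCrossSites L j a),
      ← Finset.sum_coe_sort (torusCrossSites L j a), ← sum_add_distrib, ← sum_sub_distrib]
    refine sum_congr rfl fun x _ => ?_
    rw [Sym2.lift_mk]
    exact xyRealBond_cross n g x
  rw [h1, h2, h3, xyLeftHamiltonian, xyLeftHamiltonian, map_add, map_add]
  abel

end KroneckerForm


/-! ### The sublattice rotation: `H(h)` is unitarily equivalent to `H♭(h)` -/

section Rotation

variable (L : ℕ) [NeZero L]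

/-- Pairs `(x, i)` versus edges for summands in an additive commutative monoid (side `L ≥ 3`,
where every edge is `{x, x + eᵢ}` for exactly one pair). [folklore] -/
theorem sum_pairs_eq_sum_edgeFinset' (hL : 3 ≤ L) {M : Type*} [AddCommMonoid M]
    (f : Sym2 (TorusSite d L) → M) :
    ∑ x : TorusSite d L, ∑ i : Fin d, f s(x, x + Pi.single i 1) =
      ∑ e ∈ (torusGraph d L).edgeFinset, f e := by
  set φ : TorusSite d L × Fin d → Sym2 (TorusSite d L) :=
    fun p => s(p.1, p.1 + Pi.single p.2 1) with hφ
  have hne : ∀ i : Fin d, (Pi.single i (1 : ZMod L) : TorusSite d L) ≠ 0 := by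
    haveI : Fact (1 < L) := ⟨by omega⟩
    intro i h
    have := congrFun h i
    rw [Pi.single_eq_same, Pi.zero_apply] at this
    exact one_ne_zero this
  have hmaps : ∀ p ∈ (univ : Finset (TorusSite d L × Fin d)),
      φ p ∈ (torusGraph d L).edgeFinset := by
    intro p _
    rw [SimpleGraph.mem_edgeFinset, hφ, SimpleGraph.mem_edgeSet, torusGraph_adj_iff]
    refine ⟨fun h => hne p.2 ?_, Or.inl ⟨p.2, rfl⟩⟩
    have := congrArg (· - p.1) h
    simpa using this.symm
  -- every fibre is a singleton (from the real-valued count)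
  have hfib : ∀ e ∈ (torusGraph d L).edgeFinset,
      ((univ : Finset (TorusSite d L × Fin d)).filter (fun p => φ p = e)).card = 1 := by
    intro e he
    have h := sum_pairs_eq_sum_edgeFinset L (by omega) (fun e' => if e' = e then (1 : ℝ) else 0)
    rw [if_neg (by omega : L ≠ 2), one_mul, sum_ite_eq' _ e, if_pos he] at h
    have h' : ∑ p : TorusSite d L × Fin d, (if φ p = e then (1 : ℝ) else 0) = 1 := by
      rw [Fintype.sum_prod_type]; exact h
    rw [sum_boole] at h'
    exact_mod_cast h'
  calc ∑ x : TorusSite d L, ∑ i : Fin d, f s(x, x + Pi.single i 1)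
      = ∑ p : TorusSite d L × Fin d, f (φ p) := by rw [Fintype.sum_prod_type]
    _ = ∑ e ∈ (torusGraph d L).edgeFinset,
          ∑ p ∈ (univ : Finset (TorusSite d L × Fin d)) with φ p = e, f (φ p) :=
        (sum_fiberwise_of_maps_to hmaps _).symm
    _ = ∑ e ∈ (torusGraph d L).edgeFinset, f e := by
        refine sum_congr rfl fun e he => ?_
        rw [sum_congr rfl fun p hp => by rw [(mem_filter.1 hp).2], sum_const, hfib e he, one_smul]

/-- **The field Hamiltonian as a sum over bonds**: for `L ≥ 3`,
`H(h) = Σ_{⟨xy⟩} [-½(S¹_xS¹_y + S¹_yS¹_x) - ½(S²_xS²_y + S²_yS²_x) - (h_x - h_y)(S¹_x - S¹_y)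
+ ½(h_x - h_y)²]`. [Kennedy–Lieb–Shastry, J. Stat. Phys. 53 (1988), eq. (17), XY version]
[folklore] -/
theorem xyFieldHamiltonian_eq_edgeSum (hL : 3 ≤ L) (n : ℕ) (h : TorusSite d L → ℝ) :
    xyFieldHamiltonian L n h = ∑ e ∈ (torusGraph d L).edgeFinset,
      Sym2.lift ⟨fun x y => -spinBond n 0 x y - spinBond n 1 x y -
        ((h x - h y : ℝ) : ℂ) • (siteSpin n x 0 - siteSpin n y 0) +
        (((h x - h y) ^ 2 / 2 : ℝ) : ℂ) • (1 : Op (TorusSite d L) (n + 1)), fun x y => by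
          simp only [spinBond_comm n _ x y]
          congr 2
          · rw [← neg_sub (h y) (h x), Complex.ofReal_neg, neg_smul, ← smul_neg, neg_sub]
          · rw [← neg_sub (h y) (h x), neg_sq]⟩ e := by
  have hV : xyGradField L n h = ∑ e ∈ (torusGraph d L).edgeFinset,
      Sym2.lift ⟨fun x y => ((h x - h y : ℝ) : ℂ) • (siteSpin n x 0 - siteSpin n y 0),
        fun x y => by
          dsimp only
          rw [← neg_sub (h y) (h x), Complex.ofReal_neg, neg_smul, ← smul_neg, neg_sub]⟩ e := by
    rw [xyGradField, ← sum_pairs_eq_sum_edgeFinset' L hL]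
    rfl
  have hQ : (((xyFieldEnergy L h / 2 : ℝ) : ℂ) • (1 : Op (TorusSite d L) (n + 1))) =
      ∑ e ∈ (torusGraph d L).edgeFinset,
        Sym2.lift ⟨fun x y => (((h x - h y) ^ 2 / 2 : ℝ) : ℂ) • (1 : Op (TorusSite d L) (n + 1)),
          fun x y => by dsimp only; rw [← neg_sub (h y) (h x), neg_sq]⟩ e := by
    rw [xyFieldEnergy, sum_div, Complex.ofReal_sum, sum_smul]
    simp_rw [sum_div, Complex.ofReal_sum, sum_smul]
    rw [← sum_pairs_eq_sum_edgeFinset' L hL]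
    rfl
  rw [xyFieldHamiltonian, xyTorus_eq_bondSum, hV, hQ, ← sum_sub_distrib, ← sum_add_distrib]
  refine sum_congr rfl fun e _ => ?_
  induction e using Sym2.ind with
  | h x y =>
    simp only [Sym2.lift_mk, Complex.ofReal_neg, Complex.ofReal_one, neg_smul, one_smul,
      Complex.ofReal_zero, zero_smul, add_zero]
    abel

/-- **The sublattice rotation** (Kennedy–Lieb–Shastry, J. Stat. Phys. 53 (1988), eqs.
(15)–(16); Dyson–Lieb–Simon 1978, §2): on the even torus, the rotation by `π` about the `1`-axis
on the odd sublattice maps `H(h)` to `H♭(h)`; in particular they have the same ground-state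
energy. [cite: KLS1988JSP, eqs. (15)–(17)] -/
theorem groundEnergy_xyFieldHamiltonian_eq (hL : Even L) (hL3 : 3 ≤ L) (n : ℕ)
    (h : TorusSite d L → ℝ) :
    (xyFieldHamiltonian L n h).groundEnergy = (xyRealFieldHamiltonian L n h).groundEnergy := by
  obtain ⟨k, rfl⟩ : ∃ k, L = 2 * k := ⟨L / 2, by obtain ⟨k, hk⟩ := hL; omega⟩
  set E := (torusGraph d (2 * k)).edgeFinset with hE
  -- the single-site rotation `R₁ = D² V²` (`π` about the `1`-axis): `Sˣ ↦ Sˣ`, `Sʸ ↦ -Sʸ`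
  obtain ⟨V, hV, hV', hVz, hVx, hVy⟩ := exists_unitary_conj_spinZ_eq_spinX n
  obtain ⟨D, hD, hD', hDx, hDy, hDz⟩ := exists_unitary_conj_spinX_eq_neg_spinY n
  set R₁ := D * D * (V * V) with hR₁
  have hR₁R₁ : R₁ * R₁ᴴ = 1 := by
    rw [hR₁]
    simp only [conjTranspose_mul, Matrix.mul_assoc]
    rw [← Matrix.mul_assoc V Vᴴ, hV, Matrix.one_mul, ← Matrix.mul_assoc V Vᴴ, hV, Matrix.one_mul,
      ← Matrix.mul_assoc D Dᴴ, hD, Matrix.one_mul, hD]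
  have hR₁R₁' : R₁ᴴ * R₁ = 1 := by
    rw [hR₁]
    simp only [conjTranspose_mul, Matrix.mul_assoc]
    rw [← Matrix.mul_assoc Dᴴ D, hD', Matrix.one_mul, ← Matrix.mul_assoc Dᴴ D, hD', Matrix.one_mul,
      ← Matrix.mul_assoc Vᴴ V, hV', Matrix.one_mul, hV']
  have hconj : ∀ (A B M : Matrix (Fin (n + 1)) (Fin (n + 1)) ℂ),
      A * B * M * (A * B)ᴴ = A * (B * M * Bᴴ) * Aᴴ := by
    intro A B M
    rw [conjTranspose_mul]
    simp only [Matrix.mul_assoc]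
  have hR₁x : R₁ * spinX n * R₁ᴴ = spinX n := by
    rw [hR₁, hconj, hconj V V, hVx, Matrix.mul_neg, Matrix.neg_mul, hVz, hconj D D, Matrix.mul_neg,
      Matrix.neg_mul, hDx, neg_neg, hDy]
  have hR₁y : R₁ * spinY n * R₁ᴴ = -spinY n := by
    rw [hR₁, hconj, hconj V V, hVy, hVy, hconj D D, hDy, hDx]
  -- the product unitary on the odd sublattice
  set ε : TorusSite d (2 * k) → ZMod 2 := fun x =>
    ∑ j, ZMod.castHom (dvd_mul_right 2 k) (ZMod 2) (x j) with hε
  set u : TorusSite d (2 * k) → Matrix (Fin (n + 1)) (Fin (n + 1)) ℂ :=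
    fun z => if ε z = 0 then 1 else R₁ with hu
  have hua : ∀ z, u z * (u z)ᴴ = 1 := by
    intro z; simp only [hu]; split_ifs
    · rw [conjTranspose_one, Matrix.mul_one]
    · exact hR₁R₁
  set sgn : TorusSite d (2 * k) → ℂ := fun z => if ε z = 0 then 1 else -1 with hsgn
  have hux : ∀ z, u z * spinX n * (u z)ᴴ = spinX n := by
    intro z; simp only [hu]; split_ifs
    · rw [conjTranspose_one, Matrix.mul_one, Matrix.one_mul]
    · exact hR₁x
  have huy : ∀ z, u z * spinY n * (u z)ᴴ = sgn z • spinY n := by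
    intro z; simp only [hu, hsgn]; split_ifs
    · rw [conjTranspose_one, Matrix.mul_one, Matrix.one_mul, one_smul]
    · rw [hR₁y, neg_one_smul]
  have hedge : ∀ e ∈ E, ∀ x y, e = s(x, y) → sgn x * sgn y = -1 := by
    intro e he x y hexy
    subst hexy
    rw [hE, SimpleGraph.mem_edgeFinset, SimpleGraph.mem_edgeSet, torusGraph_adj_iff] at he
    have h01 : ∀ t : ZMod 2, t = 0 ∨ t = 1 := by decide
    have key : ∀ x' : TorusSite d (2 * k), ∀ i, sgn x' * sgn (x' + Pi.single i 1) = -1 := by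
      intro x' i
      have hpar : ε (x' + Pi.single i 1) = ε x' + 1 := torusParity_add_single k x' i
      simp only [hsgn, hpar]
      rcases h01 (ε x') with h0 | h1
      · rw [if_pos h0, if_neg (by rw [h0]; decide), one_mul]
      · rw [if_neg (by rw [h1]; decide), if_pos (by rw [h1]; decide), mul_one]
    obtain ⟨-, ⟨i, rfl⟩ | ⟨i, rfl⟩⟩ := he
    · exact key x i
    · rw [mul_comm]; exact key y i
  set W := productOp u with hW
  have hWx : ∀ x : TorusSite d (2 * k), W * siteSpin n x 0 * Wᴴ = siteSpin n x 0 := by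
    intro x
    rw [hW, productOp_conj_siteSpin hua, spinVec_zero, hux]
    rfl
  have hb0 : ∀ x y : TorusSite d (2 * k), W * spinBond n 0 x y * Wᴴ = spinBond n 0 x y := by
    intro x y
    rw [hW, productOp_conj_spinBond hua (fun z => by
      rw [hu]; dsimp only; split_ifs
      · rw [conjTranspose_one, Matrix.mul_one]
      · exact hR₁R₁'), spinVec_zero, hux, hux, spinBond]
    rfl
  have hb1 : ∀ x y : TorusSite d (2 * k), sgn x * sgn y = -1 →
      W * spinBond n 1 x y * Wᴴ = -spinBond n 1 x y := by
    intro x y hxy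
    rw [hW, productOp_conj_spinBond hua (fun z => by
      rw [hu]; dsimp only; split_ifs
      · rw [conjTranspose_one, Matrix.mul_one]
      · exact hR₁R₁'), spinVec_one, huy, huy, onSite_smul', onSite_smul',
      smul_mul_smul_comm, smul_mul_smul_comm, mul_comm (sgn y) (sgn x), hxy, spinBond]
    simp only [neg_smul, one_smul]
    rw [← neg_add, smul_neg]
    rfl
  have hW1 : W * (1 : Op (TorusSite d (2 * k)) (n + 1)) * Wᴴ = 1 := by
    rw [Matrix.mul_one, hW, productOp_mul_conjTranspose hua]
  -- conjugate the edge sum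
  have hHW : W * xyFieldHamiltonian (2 * k) n h * Wᴴ = xyRealFieldHamiltonian (2 * k) n h := by
    rw [xyFieldHamiltonian_eq_edgeSum (2 * k) hL3, xyRealFieldHamiltonian, ← hE, Finset.mul_sum,
      Finset.sum_mul]
    refine sum_congr rfl fun e he => ?_
    induction e using Sym2.ind with
    | h x y =>
      have hs := hedge _ he x y rfl
      simp only [Sym2.lift_mk, xyRealBond, Matrix.mul_add, Matrix.add_mul, Matrix.mul_sub,
        Matrix.sub_mul, Matrix.mul_neg, Matrix.neg_mul, Matrix.mul_smul, Matrix.smul_mul, hb0,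
        hb1 x y hs, hW1, hWx]
      abel
  have hU : W ∈ Matrix.unitaryGroup (TensorIndex (TorusSite d (2 * k)) (n + 1)) ℂ :=
    Matrix.mem_unitaryGroup_iff.2 (by rw [hW]; exact productOp_mul_conjTranspose hua)
  rw [← hHW, Matrix.groundEnergy_unitary_conj hU]

end Rotation

end Literature.MathematicalPhysics.QuantumLattice

/-! ### Ground energy is invariant under reindexing -/

namespace Matrix

open Literature.MathematicalPhysics.QuantumLattice

variable {l m : Type*} [Fintype l] [Fintype m] [DecidableEq l] [DecidableEq m]

omit [DecidableEq l] [DecidableEq m] in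
/-- Reindexing a vector along an equivalence preserves the inner product. [folklore] -/
theorem star_comp_dotProduct_comp (e : l ≃ m) (u v : m → ℂ) :
    star (u ∘ e) ⬝ᵥ (v ∘ e) = star u ⬝ᵥ v := by
  simp only [dotProduct, Pi.star_apply, Function.comp_apply]
  exact e.sum_comp (fun i => star (u i) * v i)

/-- `E₀(A ∘ (e × e)) ≤ E₀(A)`: a ground state of `A`, reindexed, is a trial state. [folklore] -/
theorem groundEnergy_submatrix_le [Nonempty m] {A : Matrix m m ℂ} (hA : A.IsHermitian)
    (e : l ≃ m) : (A.submatrix e e).groundEnergy ≤ A.groundEnergy := by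
  obtain ⟨φ, hφ1, hφE⟩ := exists_groundState_unit hA
  have hB : (A.submatrix e e).IsHermitian := hA.submatrix e
  have h := groundEnergy_le_rayleigh_holds hB (φ ∘ e) (by rw [star_comp_dotProduct_comp, hφ1])
  rw [submatrix_mulVec_equiv, show (φ ∘ ⇑e) ∘ ⇑e.symm = φ by
    rw [Function.comp_assoc, Equiv.self_comp_symm, Function.comp_id],
    star_comp_dotProduct_comp, hφE] at h
  exact h

/-- **`E₀(A ∘ (e × e)) = E₀(A)`** for an equivalence `e` of index types (conjugation by a
permutation unitary). [folklore] -/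
theorem groundEnergy_submatrix_equiv [Nonempty l] {A : Matrix m m ℂ} (hA : A.IsHermitian)
    (e : l ≃ m) : (A.submatrix e e).groundEnergy = A.groundEnergy := by
  haveI : Nonempty m := Nonempty.map e inferInstance
  refine le_antisymm (groundEnergy_submatrix_le hA e) ?_
  have h := groundEnergy_submatrix_le (hA.submatrix e) e.symm
  rwa [submatrix_submatrix, Equiv.self_comp_symm, submatrix_id_id] at h

end Matrix

namespace Literature.MathematicalPhysics.QuantumLattice

variable {d : ℕ}

/-! ### Hermiticity and reality of the half-space operators -/

section HalfSpace

variable (L : ℕ) [NeZero L] (j : Fin d) (a : ZMod L) (n : ℕ)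

/-- A `Sym2.lift` of Hermitian bond terms summed over edges is Hermitian. [folklore] -/
theorem isHermitian_sum_lift {Λ : Type*} [Fintype Λ] [DecidableEq Λ] {q : ℕ} (s : Finset (Sym2 Λ))
    (F : {f : Λ → Λ → Op Λ q // ∀ x y, f x y = f y x}) (hF : ∀ x y, (F.1 x y).IsHermitian) :
    (∑ e ∈ s, Sym2.lift F e).IsHermitian := by
  rw [IsHermitian, conjTranspose_sum]
  refine sum_congr rfl fun e _ => ?_
  induction e using Sym2.ind with
  | h x y => exact (hF x y).eq

/-- A `Sym2.lift` of real bond terms summed over edges is real. [folklore] -/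
theorem transpose_eq_conjTranspose_sum_lift {Λ : Type*} [Fintype Λ] [DecidableEq Λ] {q : ℕ}
    (s : Finset (Sym2 Λ)) (F : {f : Λ → Λ → Op Λ q // ∀ x y, f x y = f y x})
    (hF : ∀ x y, (F.1 x y)ᵀ = (F.1 x y)ᴴ) :
    (∑ e ∈ s, Sym2.lift F e)ᵀ = (∑ e ∈ s, Sym2.lift F e)ᴴ := by
  rw [transpose_sum, conjTranspose_sum]
  refine sum_congr rfl fun e _ => ?_
  induction e using Sym2.ind with
  | h x y => exact hF x y

/-- `H♭(h)` is Hermitian. [folklore] -/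
theorem xyRealFieldHamiltonian_isHermitian (h : TorusSite d L → ℝ) :
    (xyRealFieldHamiltonian L n h).IsHermitian :=
  isHermitian_sum_lift _ _ fun x y => xyRealBond_isHermitian n h x y

/-- A real scalar is self-adjoint in `ℂ`. [folklore] -/
theorem isSelfAdjoint_ofReal (r : ℝ) : IsSelfAdjoint (r : ℂ) := by
  rw [isSelfAdjoint_iff, Complex.star_def, Complex.conj_ofReal]

/-- `H^L(h)` is Hermitian. [folklore] -/
theorem xyLeftHamiltonian_isHermitian (hL : Even L) (h : TorusSite d L → ℝ) :
    (xyLeftHamiltonian L j a hL n h).IsHermitian := by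
  unfold xyLeftHamiltonian
  refine Matrix.IsHermitian.add ?_ ?_
  · rw [IsHermitian, conjTranspose_sum]
    refine sum_congr rfl fun e _ => ?_
    induction e using Sym2.ind with
    | h x y =>
      simp only [Sym2.lift_mk]
      exact (xyRealBond_isHermitian n _ _ _).eq
  · rw [IsHermitian, conjTranspose_sum]
    refine sum_congr rfl fun x _ => ?_
    exact ((isHermitian_one.smul (isSelfAdjoint_ofReal _)).sub
      ((siteSpin_isHermitian n _ 0).smul (isSelfAdjoint_ofReal _))).eq

/-- `H^L(h)` is a real matrix. [Kennedy–Lieb–Shastry, J. Stat. Phys. 53 (1988), p. 1028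
("all these matrix elements are real")] [folklore] -/
theorem xyLeftHamiltonian_transpose_eq (hL : Even L) (h : TorusSite d L → ℝ) :
    (xyLeftHamiltonian L j a hL n h)ᵀ = (xyLeftHamiltonian L j a hL n h)ᴴ := by
  unfold xyLeftHamiltonian
  rw [transpose_add, conjTranspose_add, transpose_sum, conjTranspose_sum, transpose_sum,
    conjTranspose_sum]
  congr 1
  · refine sum_congr rfl fun e _ => ?_
    induction e using Sym2.ind with
    | h x y =>
      simp only [Sym2.lift_mk]
      exact xyRealBond_transpose_eq n _ _ _
  · refine sum_congr rfl fun x _ => ?_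
    exact transpose_eq_conjTranspose_sub
      (transpose_eq_conjTranspose_ofReal_smul transpose_eq_conjTranspose_one _)
      (transpose_eq_conjTranspose_ofReal_smul (siteSpin_zero_transpose_eq n _) _)

/-- `H^L(h)` is (complex-)symmetric: `(H^L)ᵀ = H^L`. [folklore] -/
theorem xyLeftHamiltonian_transpose (hL : Even L) (h : TorusSite d L → ℝ) :
    (xyLeftHamiltonian L j a hL n h)ᵀ = xyLeftHamiltonian L j a hL n h := by
  rw [xyLeftHamiltonian_transpose_eq, (xyLeftHamiltonian_isHermitian L j a n hL h).eq]

/-- The crossing operators are real matrices. [Kennedy–Lieb–Shastry, J. Stat. Phys. 53 (1988),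
p. 1028] [folklore] -/
theorem xyCrossOp_transpose_eq (hL : Even L) (h : TorusSite d L → ℝ)
    (i : torusCrossSites L j a × Bool) :
    (xyCrossOp L j a hL n h i)ᵀ = (xyCrossOp L j a hL n h i)ᴴ := by
  rcases i with ⟨x, _ | _⟩
  · exact transpose_eq_conjTranspose_sub (siteSpin_zero_transpose_eq n _)
      (transpose_eq_conjTranspose_ofReal_smul transpose_eq_conjTranspose_one _)
  · exact I_smul_siteSpin_one_transpose_eq n _

/-- `H^L(h)` depends on `h` only through `h` on the left half. [folklore] -/
theorem xyLeftHamiltonian_congr (hL : Even L) {h₁ h₂ : TorusSite d L → ℝ}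
    (hh : ∀ x ∈ torusLeftHalf L j a, h₁ x = h₂ x) :
    xyLeftHamiltonian L j a hL n h₁ = xyLeftHamiltonian L j a hL n h₂ := by
  unfold xyLeftHamiltonian
  congr 1
  · refine sum_congr rfl fun e _ => ?_
    induction e using Sym2.ind with
    | h x y =>
      simp only [Sym2.lift_mk]
      exact xyRealBond_congr n (hh _ (torusToLeft L j a hL x).2) (hh _ (torusToLeft L j a hL y).2)
  · refine sum_congr rfl fun x hx => ?_
    rw [hh x (mem_filter.1 hx).1]

/-- The crossing operators depend on `h` only through `h` on the left half. [folklore] -/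
theorem xyCrossOp_congr (hL : Even L) {h₁ h₂ : TorusSite d L → ℝ}
    (hh : ∀ x ∈ torusLeftHalf L j a, h₁ x = h₂ x) :
    xyCrossOp L j a hL n h₁ = xyCrossOp L j a hL n h₂ := by
  funext i
  rcases i with ⟨x, _ | _⟩
  · show siteSpin n _ 0 - _ = siteSpin n _ 0 - _
    rw [hh x (mem_filter.1 x.2).1]
  · rfl

/-- `h^L = h` on the left half. [folklore] -/
theorem reflectFieldLeft_of_mem (h : TorusSite d L → ℝ) {x : TorusSite d L}
    (hx : x ∈ torusLeftHalf L j a) : reflectFieldLeft L j a h x = h x := by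
  simp [reflectFieldLeft, hx]

/-- `h^L ∘ θ = h` on the left half. [folklore] -/
theorem reflectFieldLeft_reflectBetweenSites_of_mem (hL : Even L) (h : TorusSite d L → ℝ)
    {x : TorusSite d L} (hx : x ∈ torusLeftHalf L j a) :
    reflectFieldLeft L j a h (Torus.reflectBetweenSites j a x) = h x := by
  have hx' : Torus.reflectBetweenSites j a x ∉ torusLeftHalf L j a := fun h' =>
    (reflectBetweenSites_mem_torusLeftHalf_iff L j a hL x).1 h' hx
  show (if Torus.reflectBetweenSites j a x ∈ torusLeftHalf L j a then h (Torus.reflectBetweenSites j a x)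
    else h (Torus.reflectBetweenSites j a (Torus.reflectBetweenSites j a x))) = h x
  rw [if_neg hx', reflectBetweenSites_reflectBetweenSites]

/-- `h^R = h ∘ θ` on the left half. [folklore] -/
theorem reflectFieldRight_of_mem (h : TorusSite d L → ℝ) {x : TorusSite d L}
    (hx : x ∈ torusLeftHalf L j a) : reflectFieldRight L j a h x = h (Torus.reflectBetweenSites j a x) := by
  simp [reflectFieldRight, hx]

/-- `h^R ∘ θ = h ∘ θ` on the left half. [folklore] -/
theorem reflectFieldRight_reflectBetweenSites_of_mem (hL : Even L) (h : TorusSite d L → ℝ)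
    {x : TorusSite d L} (hx : x ∈ torusLeftHalf L j a) :
    reflectFieldRight L j a h (Torus.reflectBetweenSites j a x) = h (Torus.reflectBetweenSites j a x) := by
  have hx' : Torus.reflectBetweenSites j a x ∉ torusLeftHalf L j a := fun h' =>
    (reflectBetweenSites_mem_torusLeftHalf_iff L j a hL x).1 h' hx
  show (if Torus.reflectBetweenSites j a x ∈ torusLeftHalf L j a
    then h (Torus.reflectBetweenSites j a (Torus.reflectBetweenSites j a x))
    else h (Torus.reflectBetweenSites j a x)) = h (Torus.reflectBetweenSites j a x)
  rw [if_neg hx']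

/-- **The reflection inequality for the ground-state energy** (Kennedy–Lieb–Shastry, J. Stat.
Phys. 53 (1988), the display after eq. (25)): for the XY field Hamiltonian on the even torus of
side `L ≥ 4` and every pair of planes `P`,
`½E(h^L) + ½E(h^R) ≤ E(h)`. [cite: KLS1988JSP, eqs. (20)–(25)] -/
theorem groundEnergy_reflect_le (hL : Even L) (hL3 : 3 ≤ L) (h : TorusSite d L → ℝ) :
    ((xyFieldHamiltonian L n (reflectFieldLeft L j a h)).groundEnergy +
        (xyFieldHamiltonian L n (reflectFieldRight L j a h)).groundEnergy) / 2 ≤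
      (xyFieldHamiltonian L n h).groundEnergy := by
  rw [groundEnergy_xyFieldHamiltonian_eq L hL hL3, groundEnergy_xyFieldHamiltonian_eq L hL hL3,
    groundEnergy_xyFieldHamiltonian_eq L hL hL3]
  -- abbreviations
  set A := xyLeftHamiltonian L j a hL n h with hA
  set B := xyLeftHamiltonian L j a hL n (fun y => h (Torus.reflectBetweenSites j a y)) with hB
  set M := xyCrossOp L j a hL n h with hM
  set N := xyCrossOp L j a hL n (fun y => h (Torus.reflectBetweenSites j a y)) with hN
  set e := torusSplit (q := n + 1) L j a hL with he
  -- the three Kronecker forms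
  have hK : xyRealFieldHamiltonian L n h =
      (A ⊗ₖ 1 + 1 ⊗ₖ B - ∑ i, M i ⊗ₖ N i).submatrix e e :=
    xyRealFieldHamiltonian_eq_submatrix L j a hL n h
  have hKL : xyRealFieldHamiltonian L n (reflectFieldLeft L j a h) =
      (A ⊗ₖ 1 + 1 ⊗ₖ A - ∑ i, M i ⊗ₖ M i).submatrix e e := by
    rw [xyRealFieldHamiltonian_eq_submatrix L j a hL n,
      xyLeftHamiltonian_congr L j a n hL (fun x hx => reflectFieldLeft_of_mem L j a h hx),
      xyLeftHamiltonian_congr L j a n hL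
        (fun x hx => reflectFieldLeft_reflectBetweenSites_of_mem L j a hL h hx),
      xyCrossOp_congr L j a n hL (fun x hx => reflectFieldLeft_of_mem L j a h hx),
      xyCrossOp_congr L j a n hL (fun x hx => reflectFieldLeft_reflectBetweenSites_of_mem L j a hL h hx)]
  have hKR : xyRealFieldHamiltonian L n (reflectFieldRight L j a h) =
      (B ⊗ₖ 1 + 1 ⊗ₖ B - ∑ i, N i ⊗ₖ N i).submatrix e e := by
    rw [xyRealFieldHamiltonian_eq_submatrix L j a hL n,
      xyLeftHamiltonian_congr L j a n hL (fun x hx => reflectFieldRight_of_mem L j a h hx),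
      xyLeftHamiltonian_congr L j a n hL
        (h₁ := fun y => reflectFieldRight L j a h (Torus.reflectBetweenSites j a y))
        (fun x hx => reflectFieldRight_reflectBetweenSites_of_mem L j a hL h hx),
      xyCrossOp_congr L j a n hL (fun x hx => reflectFieldRight_of_mem L j a h hx),
      xyCrossOp_congr L j a n hL (h₁ := fun y => reflectFieldRight L j a h (Torus.reflectBetweenSites j a y))
        (fun x hx => reflectFieldRight_reflectBetweenSites_of_mem L j a hL h hx)]
  -- Hermiticity of the three forms
  have herm : ∀ (f : TorusSite d L → ℝ) (K : Matrix _ _ ℂ),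
      xyRealFieldHamiltonian L n f = K.submatrix e e → K.IsHermitian := by
    intro f K hf
    have : K = (xyRealFieldHamiltonian L n f).submatrix e.symm e.symm := by
      rw [hf, submatrix_submatrix, Equiv.self_comp_symm, submatrix_id_id]
    rw [this]
    exact (xyRealFieldHamiltonian_isHermitian L n f).submatrix _
  haveI : Nonempty ((torusLeftHalf L j a → Fin (n + 1)) × (torusLeftHalf L j a → Fin (n + 1))) :=
    ⟨(fun _ => 0, fun _ => 0)⟩
  have hRP := Matrix.kls_groundEnergy_reflection A B M N (xyLeftHamiltonian_transpose L j a n hL h)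
    (xyLeftHamiltonian_transpose L j a n hL _) (fun i => xyCrossOp_transpose_eq L j a n hL h i)
    (fun i => xyCrossOp_transpose_eq L j a n hL _ i) (herm _ _ hK) (herm _ _ hKL) (herm _ _ hKR)
  rw [hK, hKL, hKR, Matrix.groundEnergy_submatrix_equiv (herm _ _ hK),
    Matrix.groundEnergy_submatrix_equiv (herm _ _ hKL),
    Matrix.groundEnergy_submatrix_equiv (herm _ _ hKR)]
  exact hRP

end HalfSpace


/-! ### Counting the bonds with `h_x ≠ h_y` under reflection -/

section Counting

variable (L : ℕ) [NeZero L] (j : Fin d) (a : ZMod L)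

/-- The bad-bond count as a sum of indicators over the edges. [folklore] -/
theorem badBondCount_eq_sum (h : TorusSite d L → ℝ) :
    badBondCount L h = ∑ e ∈ (torusGraph d L).edgeFinset, if (e.map h).IsDiag then 0 else 1 := by
  rw [badBondCount, Finset.card_filter]
  refine sum_congr rfl fun e _ => ?_
  split_ifs <;> simp_all

/-- **Bad bonds under reflection** (the counting step of the descent of Kennedy–Lieb–Shastry,
J. Stat. Phys. 53 (1988), p. 1029: "at least one choice, `h^R` or `h^L`, has the property that it
has strictly fewer bonds with `h_x ≠ h_y` than does the original `h̄`"): with `N` the number of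
bad bonds and `N_C` the number of bad crossing bonds,
`N(h^L) + N(h^R) + 2N_C(h) = 2N(h)`. [cite: KLS1988JSP, p. 1029] -/
theorem badBondCount_reflect (hL : Even L) (h : TorusSite d L → ℝ) :
    badBondCount L (reflectFieldLeft L j a h) + badBondCount L (reflectFieldRight L j a h) +
        2 * ∑ x ∈ torusCrossSites L j a,
          (if (s(x, Torus.reflectBetweenSites j a x).map h).IsDiag then 0 else 1) =
      2 * badBondCount L h := by
  -- indicator
  set I : (TorusSite d L → ℝ) → Sym2 (TorusSite d L) → ℕ := fun φ e =>
    if (e.map φ).IsDiag then 0 else 1 with hI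
  have hIcongr : ∀ (φ ψ : TorusSite d L → ℝ) (u v u' v' : TorusSite d L),
      φ u = ψ u' → φ v = ψ v' → I φ s(u, v) = I ψ s(u', v') := by
    intro φ ψ u v u' v' hu hv
    simp only [hI, Sym2.map_mk, hu, hv]
    split_ifs <;> rfl
  set hLf := reflectFieldLeft L j a h with hhL
  set hRf := reflectFieldRight L j a h with hhR
  -- values of the reflected fields
  have hL1 : ∀ x ∈ torusLeftHalf L j a, hLf x = h x := fun x hx => by simp [hhL, reflectFieldLeft, hx]
  have hL2 : ∀ x ∈ torusLeftHalf L j a, hLf (Torus.reflectBetweenSites j a x) = h x :=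
    fun x hx => by rw [hhL]; exact reflectFieldLeft_reflectBetweenSites_of_mem L j a hL h hx
  have hR1 : ∀ x ∈ torusLeftHalf L j a, hRf x = h (Torus.reflectBetweenSites j a x) := fun x hx => by
    simp [hhR, reflectFieldRight, hx]
  have hR2 : ∀ z, z ∉ torusLeftHalf L j a → hRf z = h z := fun z hz => by
    simp [hhR, reflectFieldRight, hz]
  -- the three splittings
  rw [badBondCount_eq_sum, badBondCount_eq_sum, badBondCount_eq_sum,
    sum_edgeFinset_split L j a hL (I hLf), sum_edgeFinset_split L j a hL (I hRf),
    sum_edgeFinset_split L j a hL (I h)]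
  -- left bonds
  have eLL : ∑ e ∈ torusLeftEdges L j a, I hLf e = ∑ e ∈ torusLeftEdges L j a, I h e := by
    refine sum_congr rfl fun e he => ?_
    obtain ⟨-, hl⟩ := mem_filter.1 he
    revert hl; refine Sym2.ind (fun u v => ?_) e; intro hl
    exact hIcongr _ _ u v u v (hL1 u (hl u (Sym2.mem_mk_left u v)))
      (hL1 v (hl v (Sym2.mem_mk_right u v)))
  have eRL : ∑ e ∈ ((torusGraph d L).edgeFinset.filter fun e => ∀ x ∈ e, x ∉ torusLeftHalf L j a),
      I hLf e = ∑ e ∈ torusLeftEdges L j a, I h e := by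
    rw [sum_rightEdges_eq_sum_leftEdges_map L j a hL]
    refine sum_congr rfl fun e he => ?_
    obtain ⟨-, hl⟩ := mem_filter.1 he
    revert hl; refine Sym2.ind (fun u v => ?_) e; intro hl
    rw [Sym2.map_mk]
    exact hIcongr _ _ _ _ u v (hL2 u (hl u (Sym2.mem_mk_left u v)))
      (hL2 v (hl v (Sym2.mem_mk_right u v)))
  have eCL : ∑ x ∈ torusCrossSites L j a, I hLf s(x, Torus.reflectBetweenSites j a x) = 0 := by
    refine sum_eq_zero fun x hx => ?_
    have hxL : x ∈ torusLeftHalf L j a := (mem_filter.1 hx).1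
    simp only [hI, Sym2.map_mk, hL1 x hxL, hL2 x hxL, Sym2.mk_isDiag_iff, if_true]
  -- right bonds
  have eLR : ∑ e ∈ torusLeftEdges L j a, I hRf e =
      ∑ e ∈ ((torusGraph d L).edgeFinset.filter fun e => ∀ x ∈ e, x ∉ torusLeftHalf L j a), I h e := by
    rw [sum_leftEdges_eq_sum_rightEdges_map L j a hL]
    refine sum_congr rfl fun e he => ?_
    obtain ⟨-, hr⟩ := mem_filter.1 he
    revert hr; refine Sym2.ind (fun u v => ?_) e; intro hr
    rw [Sym2.map_mk]
    have hu : Torus.reflectBetweenSites j a u ∈ torusLeftHalf L j a :=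
      (reflectBetweenSites_mem_torusLeftHalf_iff L j a hL u).2 (hr u (Sym2.mem_mk_left u v))
    have hv : Torus.reflectBetweenSites j a v ∈ torusLeftHalf L j a :=
      (reflectBetweenSites_mem_torusLeftHalf_iff L j a hL v).2 (hr v (Sym2.mem_mk_right u v))
    refine hIcongr _ _ _ _ u v ?_ ?_
    · rw [hR1 _ hu, reflectBetweenSites_reflectBetweenSites]
    · rw [hR1 _ hv, reflectBetweenSites_reflectBetweenSites]
  have eRR : ∑ e ∈ ((torusGraph d L).edgeFinset.filter fun e => ∀ x ∈ e, x ∉ torusLeftHalf L j a),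
      I hRf e = ∑ e ∈ ((torusGraph d L).edgeFinset.filter
        fun e => ∀ x ∈ e, x ∉ torusLeftHalf L j a), I h e := by
    refine sum_congr rfl fun e he => ?_
    obtain ⟨-, hr⟩ := mem_filter.1 he
    revert hr; refine Sym2.ind (fun u v => ?_) e; intro hr
    exact hIcongr _ _ u v u v (hR2 u (hr u (Sym2.mem_mk_left u v)))
      (hR2 v (hr v (Sym2.mem_mk_right u v)))
  have eCR : ∑ x ∈ torusCrossSites L j a, I hRf s(x, Torus.reflectBetweenSites j a x) = 0 := by
    refine sum_eq_zero fun x hx => ?_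
    have hxL : x ∈ torusLeftHalf L j a := (mem_filter.1 hx).1
    have hθ : Torus.reflectBetweenSites j a x ∉ torusLeftHalf L j a := fun h' =>
      (reflectBetweenSites_mem_torusLeftHalf_iff L j a hL x).1 h' hxL
    simp only [hI, Sym2.map_mk, hR1 x hxL, hR2 _ hθ, Sym2.mk_isDiag_iff, if_true]
  rw [eLL, eRL, eCL, eLR, eRR, eCR]
  ring

omit [NeZero L] in
/-- The planes through a given bond: for `a = x₀ⱼ`, `θ x₀ = x₀ + eⱼ`. [folklore] -/
theorem reflectBetweenSites_self_eq_add_single (x₀ : TorusSite d L) :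
    Torus.reflectBetweenSites j (x₀ j) x₀ = x₀ + Pi.single j 1 := by
  ext k
  by_cases hk : k = j
  · subst hk
    simp [Torus.reflectBetweenSites_apply]
    ring
  · simp [Torus.reflectBetweenSites_apply, hk]

/-- For `a = x₀ⱼ`, the site `x₀ + eⱼ` is in the (bottom layer of the) left half. [folklore] -/
theorem add_single_mem_torusLeftHalf (hL2 : 2 ≤ L) (x₀ : TorusSite d L) :
    x₀ + Pi.single j 1 ∈ torusLeftHalf L j (x₀ j) := by
  rw [mem_torusLeftHalf, Pi.add_apply, Pi.single_eq_same, sub_self, ZMod.val_zero]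
  omega

end Counting


section Descent

variable (L : ℕ) [NeZero L]

omit [NeZero L] in
/-- The unit vectors of the torus are nonzero for `L ≥ 2`. [folklore] -/
theorem single_ne_zero_of_two_le (hL2 : 2 ≤ L) (i : Fin d) :
    (Pi.single i (1 : ZMod L) : TorusSite d L) ≠ 0 := by
  haveI : Fact (1 < L) := ⟨by omega⟩
  intro h
  have := congrFun h i
  rw [Pi.single_eq_same, Pi.zero_apply] at this
  exact one_ne_zero this

omit [NeZero L] in
/-- `x ~ x + eᵢ` in the torus graph (`L ≥ 2`). [folklore] -/
theorem torusGraph_adj_add_single (hL2 : 2 ≤ L) (x : TorusSite d L) (i : Fin d) :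
    (torusGraph d L).Adj x (x + Pi.single i 1) := by
  rw [torusGraph_adj_iff]
  refine ⟨fun h => single_ne_zero_of_two_le L hL2 i ?_, Or.inl ⟨i, rfl⟩⟩
  have := congrArg (· - x) h
  simpa using this.symm

/-- For `a = x₀ⱼ`, the site `x₀ + eⱼ` is a crossing site and its crossing bond is `{x₀ + eⱼ, x₀}`.
[folklore] -/
theorem add_single_mem_torusCrossSites (hL2 : 2 ≤ L) (j : Fin d) (x₀ : TorusSite d L) :
    x₀ + Pi.single j 1 ∈ torusCrossSites L j (x₀ j) ∧
      Torus.reflectBetweenSites j (x₀ j) (x₀ + Pi.single j 1) = x₀ := by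
  have hθ : Torus.reflectBetweenSites j (x₀ j) (x₀ + Pi.single j 1) = x₀ := by
    rw [← reflectBetweenSites_self_eq_add_single L j x₀, reflectBetweenSites_reflectBetweenSites]
  refine ⟨mem_filter.2 ⟨add_single_mem_torusLeftHalf L j hL2 x₀, ?_⟩, hθ⟩
  rw [hθ]
  exact (torusGraph_adj_add_single L hL2 x₀ j).symm

/-- **No bad bonds ⇒ `H(h) = H`**: if `h_x = h_y` on every bond then the field terms vanish.
[Kennedy–Lieb–Shastry, J. Stat. Phys. 53 (1988), p. 1027 ("(18) is equivalent to proving that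
E(h) attains its minimum when `h_x` is a constant")] [folklore] -/
theorem xyFieldHamiltonian_eq_of_badBondCount_eq_zero (hL2 : 2 ≤ L) (n : ℕ)
    {h : TorusSite d L → ℝ} (h0 : badBondCount L h = 0) :
    xyFieldHamiltonian L n h = xyTorus d L n := by
  classical
  have hgood : ∀ (x : TorusSite d L) (i : Fin d), h x - h (x + Pi.single i 1) = 0 := by
    intro x i
    rw [badBondCount, Finset.card_eq_zero, Finset.filter_eq_empty_iff] at h0
    have he : s(x, x + Pi.single i 1) ∈ (torusGraph d L).edgeFinset := by
      rw [SimpleGraph.mem_edgeFinset, SimpleGraph.mem_edgeSet]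
      exact torusGraph_adj_add_single L hL2 x i
    have h1 := h0 he
    rw [not_not, Sym2.map_mk, Sym2.mk_isDiag_iff] at h1
    rw [h1, sub_self]
  have hV : xyGradField L n h = 0 := by
    unfold xyGradField
    exact sum_eq_zero fun x _ => sum_eq_zero fun i _ => by
      rw [hgood x i, Complex.ofReal_zero, zero_smul]
  have hQ : xyFieldEnergy L h = 0 := by
    unfold xyFieldEnergy
    exact sum_eq_zero fun x _ => sum_eq_zero fun i _ => by rw [hgood x i]; ring
  rw [xyFieldHamiltonian, hV, hQ, sub_zero, zero_div, Complex.ofReal_zero, zero_smul, add_zero]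

/-- **Discharge of (GD)** `kls_xy_gaussianDomination_ground`: ground-state Gaussian domination
`E₀(H) ≤ E₀(H(h))` for the XY model on even tori of side `L ≥ 4`, all `d`, all spins, all real
fields. Proof (Kennedy–Lieb–Shastry, J. Stat. Phys. 53 (1988), pp. 1027–1029): minimise
`E(f) = E₀(H(f))` over the finitely many fields `f` with values in the range of `h`, and among
the minimisers take one with the fewest bonds `{x,y}` with `f_x ≠ f_y`; if there were such a
bond, the planes through it give `½E(f^L) + ½E(f^R) ≤ E(f)` (`groundEnergy_reflect_le`), so
`f^L`, `f^R` are minimisers too, and one of them has fewer bad bonds (`badBondCount_reflect`) —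
contradiction; hence the minimiser is constant on bonds, `H(f) = H`, and `E₀(H) ≤ E₀(H(h))`.
[cite: KLS1988JSP, eq. (18) and pp. 1027–1029] [cite: KLS1988PRL, after eq. (4)] -/
theorem kls_xy_gaussianDomination_ground_holds : kls_xy_gaussianDomination_ground := by
  intro d n L _ hL h4 g
  classical
  have hL3 : 3 ≤ L := by omega
  have hL2 : 2 ≤ L := by omega
  -- the finite search space
  set V : Finset ℝ := (univ : Finset (TorusSite d L)).image g with hV
  set Ef : (TorusSite d L → V) → ℝ := fun f =>
    (xyFieldHamiltonian L n (fun x => (f x : ℝ))).groundEnergy with hEf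
  set Nf : (TorusSite d L → V) → ℕ := fun f => badBondCount L (fun x => (f x : ℝ)) with hNf
  set g' : TorusSite d L → V := fun x => ⟨g x, mem_image_of_mem g (mem_univ x)⟩ with hg'
  haveI : Nonempty (TorusSite d L → V) := ⟨g'⟩
  obtain ⟨f₀, hf₀⟩ := Finite.exists_min Ef
  set S : Finset (TorusSite d L → V) := univ.filter fun f => Ef f = Ef f₀ with hS
  obtain ⟨f₁, hf₁S, hf₁min⟩ := S.exists_min_image Nf ⟨f₀, by simp [hS]⟩
  have hEf₁ : Ef f₁ = Ef f₀ := (mem_filter.1 hf₁S).2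
  -- the minimiser has no bad bonds
  have hN0 : Nf f₁ = 0 := by
    by_contra hN
    -- a bad pair `(x₀, i)`
    obtain ⟨x₀, i, hbad⟩ : ∃ (x₀ : TorusSite d L) (i : Fin d),
        (f₁ x₀ : ℝ) ≠ f₁ (x₀ + Pi.single i 1) := by
      obtain ⟨e, he⟩ := Finset.card_ne_zero.1 hN
      obtain ⟨heE, hbe⟩ := mem_filter.1 he
      revert heE hbe
      refine Sym2.ind (fun u v => ?_) e
      intro heE hbe
      rw [SimpleGraph.mem_edgeFinset, SimpleGraph.mem_edgeSet, torusGraph_adj_iff] at heE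
      rw [Sym2.map_mk, Sym2.mk_isDiag_iff] at hbe
      obtain ⟨-, ⟨i, rfl⟩ | ⟨i, rfl⟩⟩ := heE
      · exact ⟨u, i, hbe⟩
      · exact ⟨v, i, fun h' => hbe h'.symm⟩
    -- the planes through it
    set j := i
    obtain ⟨hxCS, hθx⟩ := add_single_mem_torusCrossSites L hL2 j x₀
    set a : ZMod L := x₀ j with ha
    -- the reflected fields, inside the search space
    set φ : TorusSite d L → ℝ := fun x => (f₁ x : ℝ) with hφ
    set fL : TorusSite d L → V := fun y =>
      if y ∈ torusLeftHalf L j a then f₁ y else f₁ (Torus.reflectBetweenSites j a y) with hfL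
    set fR : TorusSite d L → V := fun y =>
      if y ∈ torusLeftHalf L j a then f₁ (Torus.reflectBetweenSites j a y) else f₁ y with hfR
    have hfLφ : (fun x => (fL x : ℝ)) = reflectFieldLeft L j a φ := by
      funext y
      simp only [hfL, reflectFieldLeft, hφ]
      split_ifs <;> rfl
    have hfRφ : (fun x => (fR x : ℝ)) = reflectFieldRight L j a φ := by
      funext y
      simp only [hfR, reflectFieldRight, hφ]
      split_ifs <;> rfl
    -- energies: both reflected fields are minimisers
    have hRP := groundEnergy_reflect_le L j a n hL hL3 φ
    have hEL : Ef fL = (xyFieldHamiltonian L n (reflectFieldLeft L j a φ)).groundEnergy := by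
      simp only [hEf, hfLφ]
    have hER : Ef fR = (xyFieldHamiltonian L n (reflectFieldRight L j a φ)).groundEnergy := by
      simp only [hEf, hfRφ]
    have hE1 : Ef f₁ = (xyFieldHamiltonian L n φ).groundEnergy := by simp only [hEf, hφ]
    have h1 := hf₀ fL
    have h2 := hf₀ fR
    rw [← hEL, ← hER, ← hE1, hEf₁] at hRP
    have hELm : Ef fL = Ef f₀ := by linarith
    have hERm : Ef fR = Ef f₀ := by linarith
    have hNL : Nf f₁ ≤ Nf fL := hf₁min fL (by simp [hS, hELm])
    have hNR : Nf f₁ ≤ Nf fR := hf₁min fR (by simp [hS, hERm])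
    -- counting: `N(f^L) + N(f^R) + 2N_C = 2N(f)` with `N_C ≥ 1`
    have hcount := badBondCount_reflect L j a hL φ
    have hNLφ : Nf fL = badBondCount L (reflectFieldLeft L j a φ) := by simp only [hNf, hfLφ]
    have hNRφ : Nf fR = badBondCount L (reflectFieldRight L j a φ) := by simp only [hNf, hfRφ]
    have hN1φ : Nf f₁ = badBondCount L φ := by simp only [hNf, hφ]
    have hC : 1 ≤ ∑ x ∈ torusCrossSites L j a,
        (if (Sym2.map φ s(x, Torus.reflectBetweenSites j a x)).IsDiag then 0 else 1) := by
      have hone : (if (Sym2.map φ s(x₀ + Pi.single j 1,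
          Torus.reflectBetweenSites j a (x₀ + Pi.single j 1))).IsDiag then 0 else 1) = 1 := by
        simp only [hθx, Sym2.map_mk, Sym2.mk_isDiag_iff]
        rw [if_neg]
        exact fun h' => hbad h'.symm
      calc 1 = (if (Sym2.map φ s(x₀ + Pi.single j 1,
          Torus.reflectBetweenSites j a (x₀ + Pi.single j 1))).IsDiag then 0 else 1) := hone.symm
        _ ≤ _ := Finset.single_le_sum (f := fun x =>
          if (Sym2.map φ s(x, Torus.reflectBetweenSites j a x)).IsDiag then 0 else 1)
          (fun _ _ => Nat.zero_le _) hxCS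
    rw [← hNLφ, ← hNRφ, ← hN1φ] at hcount
    omega
  -- hence `H(f₁) = H` and `E₀(H) = E(f₁) ≤ E(g)`
  have hH : xyFieldHamiltonian L n (fun x => (f₁ x : ℝ)) = xyTorus d L n :=
    xyFieldHamiltonian_eq_of_badBondCount_eq_zero L hL2 n hN0
  have hEg : Ef g' = (xyFieldHamiltonian L n g).groundEnergy := by simp only [hEf, hg']
  have h1 : Ef f₁ = (xyTorus d L n).groundEnergy := by simp only [hEf, hH]
  rw [← hEg, ← h1, hEf₁]
  exact hf₀ g'

end Descent

/-- **The Kennedy–Lieb–Shastry theorem** (discharge of `kennedy_lieb_shastry_xy_ground`): the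
quantum XY model `H = -Σ_{⟨xy⟩} (S¹_xS¹_y + S²_xS²_y)` on `ℤ^d` has ground-state long-range
order for every spin `S ≥ ½` and every dimension `d ≥ 2` — `liminf_{L even} |Λ_L|⁻² Σ_{x,y}
Σ_{α=1,2} ω_L(Sᵅ_xSᵅ_y) > 0` for the ground states of the tori `(ℤ/Lℤ)^d`. All inputs are now
proved: (A) from (GD) (`XYOrderInfraredProofs`), (GD) above, (B), (C), (D), (S), (T)
(`XYOrderDischarges`), (E), (R'') (`XYOrderIntegralProofs`), assembled by
`kennedy_lieb_shastry_xy_ground_of_riemannSum_le` (`XYOrderProofs`).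
[Kennedy–Lieb–Shastry 1988, Theorem] [cite: KLS1988PRL, Theorem] -/
theorem kennedy_lieb_shastry_xy_ground_holds : kennedy_lieb_shastry_xy_ground :=
  kennedy_lieb_shastry_xy_ground_of_gaussianDomination kls_xy_gaussianDomination_ground_holds

end Literature.MathematicalPhysics.QuantumLattice
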